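import Literature.MathematicalPhysics.QuantumFieldTheory.Balaban1983to89.BlockAveragingExpMeanLog
import Literature.Analysis.SpecialFunctions.LogFDeriv

/-!
# FEDERBUSH'S IMPLICIT GROUP AVERAGE (0.10) of [Balaban1987RG1] — `Σ_j (1/i) log (U_j M⁻¹) = 0` — CONSTRUCTED on
# `U(N)` and `SU(N)` for every `N`, with (0.5), (0.6) two-sided, (0.7), (0.9) and a quantitative (0.8) PROVED:
# inhabitants `federbushU : GroupAverage U(N)` and `federbushSU : GroupAverage SU(N)`, measurable at every arity

T. Bałaban, *Renormalization group approach to lattice gauge field theories. I*, Comm. Math. Phys. **109** (1987)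
249–301 (`Balaban1987RG1`, "B12"), §0 p. 253 (render read as image; loci certified in the audit cells C-pv26g2-4,
C-pv26g3-2, C-ref5-78 of the programme that commissioned this file):

«There are several proposals how to define such averages, see [74, 75, 35]. Let us write a definition which is
equivalent to the one given by Federbush in [35]. The average of the set {U_j} is the element U ∈ Gᶜ such that U_j
are in a small neighborhood of U, and it satisfies the equation Σ_{j=1}^{n} (1/i) log U_j U⁻¹ = 0. (0.10) This
definition has all the properties listed above, as it was proved by Federbush in [35 (II)].»

The "properties listed above" (same page): «M({U_j⁻¹}) = M({U_j})⁻¹; (0.5) M({uU_jv}) = uM({U_j})v; (0.6)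
M(π{U_j}) = M({U_j}) for an arbitrary permutation π of the set {U_j}; (0.7)», «for a set {U_j} of elements close
to the identity of the group, i.e. U_j = exp iA_j with A_j in a small neighborhood of 0 in gᶜ, the average is close
to the identity also, and (1/i) log M({exp iA_j}) = (1/n) Σ_{j=1}^{n} A_j + (higher order terms); (0.8) if U_j ∈ G,
then M({U_j}) ∈ G also. (0.9)», and «The considerations and results of this, and previous papers, do not depend on
any particular averaging operation used; they are valid universally for all averages satisfying the above
properties.»  Reference [35 (II)] of B12 is an unpublished University of Michigan preprint; NOTHING from it is used
or cited here — the file gives a self-contained construction and proof (the tree's `Setup.GroupAverage` docstring: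
"print's own proposal (0.10) is not formalised" — it now is, for `G = U(N), SU(N)`).

## What this file DEFINES and PROVES (nothing printed is asserted; `log` = the series logarithm `MatrixLog.mlog` (21))

Throughout, a family is `U₀, …, U_m` (`Fin (m+1) → G`, every arity `m`), `W_j = U_j U₀*` its relative family, and
the unknown of (0.10) is written `X = (M U₀⁻¹)⁻¹`, so that `U_j M⁻¹ = W_j X` and (0.10) reads
`fed W X := |I|⁻¹ Σ_j log (W_j X) = 0` (§2; the factor `1/i` and the normalisation `|I|⁻¹` are immaterial).

* §1 (any complete normed `ℂ`-algebra) the MEAN-VALUE DEFECT of the series logarithm: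
  `‖log A − log B − (A − B)‖ ≤ ρ/(1 − ρ) · ‖A − B‖` on `‖· − 1‖ ≤ ρ < 1` (`norm_mlog_sub_mlog_sub_le`; mean-value
  inequality with the tree's derivative bound `LogFDeriv.norm_tsum_term_sub_id_le`), and a Neumann-series inverse
  bound (`isUnit_and_norm_inverse_sub_one_le`).
* §2 the map `fed W` is `1/6`-APPROXIMATELY THE IDENTITY on the ball `‖X − 1‖ ≤ 2/25` for every family with
  `‖W_j − 1‖ ≤ 1/100`, UNIFORMLY IN THE ARITY (`approximatesLinearOn_fed` — an average of termwise bounds is the same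
  bound); hence, by Mathlib's quantitative surjectivity / injectivity of such maps
  (`ApproximatesLinearOn.surjOn_closedBall_of_nonlinearRightInverse`, `.injOn`): EXISTENCE of a solution with
  `‖X − 1‖ ≤ 3δ` for `‖W_j − 1‖ ≤ δ ≤ 1/100` (`exists_fed_eq_zero`) and UNIQUENESS in `‖X − 1‖ ≤ 2/25` (`injOn_fed`).
  §2b the solution map `fedSol` (`fed_fedSol`, `fedSol_unique`, `norm_fedSol_sub_one_le`), its permutation and
  conjugation covariance (`fedSol_comp_equiv`, `fedSol_conj`), LIPSCHITZ dependence on the family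
  (`norm_fedSol_sub_fedSol_le`, constant `2`, sup norm) hence continuity on the open set of small families
  (`continuousOn_fedSol`), and (0.8) QUANTIFIED: `‖log X + |I|⁻¹ Σ_j log W_j‖ ≤ 35 δ²` (`norm_mlog_fedSol_add_fed_one_le`;
  the constant `35` is the FILE's — print says "(higher order terms)").
* §3 (`M_N(ℂ)`, `L²`-operator norm) (0.9): for a unitary family the solution is UNITARY (`fedSol_mem_unitaryGroup`: the
  adjoint-inverse `(X⁻¹)*` solves the same equation in the uniqueness ball), and for a special unitary family of radius
  `δ ≤ min(1/100, 1/(3N))` it has DETERMINANT ONE (`det_fedSol_eq_one`: the numbers `tr log (W_j X)` have equal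
  exponentials `det X` and modulus `< π`, so they coincide, and their sum vanishes).  The `1/N` in the radius cannot be
  removed (for the `SU(N)`-family `{e^{2πi/N}·1, 1}` the implicit mean is `e^{± iπ/N}·1`, of determinant `−1`; cf. the
  located remark G-pv11g6-1 of `BlockAveragingExpMeanLog` for the exp-mean-log average) — not formalised here.
* §4 the group average `fedM δ U = X* U₀` on matrix families (guard: all `‖U_i U_k* − 1‖ < δ`; value `U₀` off it):
  (0.10) `Σ_j log (U_j (fedM δ U)*) = 0` (`sum_mlog_mul_star_fedM`), LOCAL UNIQUENESS (`fedM_unique`: any `M` with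
  `‖M U₀* − 1‖ ≤ 2/25` solving (0.10) is `fedM δ U`), and — each as an instance of uniqueness, exactly as the hand
  proof goes — (0.5) `fedM_star` (`log (U_j* M) = −M* log (U_j M*) M`), (0.6) TWO-SIDED `fedM_conj`
  (`log (uU_jv (uMv)*) = u log (U_j M*) u*`), (0.7) with independence of the base point `fedM_perm`, constants
  `fedM_const`, and closeness to the base point `norm_fedM_mul_star_sub_one_le(_of_le)`.
* §5 the inhabitants `federbushU : GroupAverage (Matrix.unitaryGroup n ℂ)` (radius `1/100`) and
  `federbushSU : GroupAverage (Matrix.specialUnitaryGroup n ℂ)` (radius `deltaFed n = min(1/100, 1/(3N))`) of the tree's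
  `Setup.GroupAverage` — fields `inv` (0.5), `equivariant` (0.6, two-sided), `perm` (0.7) PROVED on `FamilySmall δ`
  families (in the model `dist1 U = ‖U − 1‖`, `UnitaryModel` §4, so `FamilySmall δ U` IS the guard, `familySmall_SU_iff`);
  that they SOLVE (0.10) (`federbushSU_solves`, `federbushU_solves`), local uniqueness at group level
  (`federbushSU_unique`), constants (`federbushSU_const`), closeness (`federbushSU_dist1_le`), and MEASURABILITY AT
  EVERY ARITY (`measurable_fedMSU`, `measurable_fedMU`, `federbushSU_measurable`, `federbushU_measurable` — the body of
  `T4ApexTwoLevel.GroupAverage.MeasurableM`, stated here without importing that module): the guard is open, on it the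
  map is continuous (Lipschitz `fedSol`), off it it is `U ↦ U₀`.

## What is NOT encoded (divergences from print, recorded in the programme's DIVERGENCES file)

* print's `M` is `Gᶜ`-valued and ANALYTIC on small-diameter `Gᶜ`-families; here `M` is constructed on `G`-families
  only (`G = U(N), SU(N)`), and analyticity / `C¹` of `U ↦ M U` is NOT proved (Lipschitz continuity is).  The same
  construction runs verbatim on `GL_N(ℂ)`-families near the diagonal, and analyticity follows from the analytic
  implicit function theorem; neither is done in this file.
* the guard is a fixed numerical radius (`1/100`, resp. `min(1/100, 1/(3N))`), not print's unspecified "sufficiently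
  small diameters"; the constants `1/6`, `2/25`, `3δ`, `2`, `35` are the FILE's.
* `log` is the power series (21) about `1`, not a principal matrix logarithm (they agree where both are used, cf.
  `BlockAveragingExpMeanLog` §3, but this is not restated).

Model conventions: `[cite: Balaban1987RG1, (0.k) p.253]` tags sit only on the declarations verifying the corresponding
printed property for THIS constructed `M`; everything else is `[folklore]` (Banach-algebra calculus).
-/

noncomputable section

open NormedSpace Metric Set
open scoped NNReal

namespace Literature.MathematicalPhysics.QuantumFieldTheory.Balaban1983to89

namespace FederbushMean

open MatrixLog ExpMeanLog
open Literature.Analysis.SpecialFunctions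

section Banach

variable {𝔸 : Type*} [NormedRing 𝔸] [NormedAlgebra ℂ 𝔸] [CompleteSpace 𝔸]

/-! ## 1. The mean-value defect of the series logarithm -/

/-- `t/(1 − t)` is monotone on `(-∞, 1)`. [folklore] -/
theorem div_one_sub_le_div_one_sub {t ρ : ℝ} (htρ : t ≤ ρ) (hρ : ρ < 1) :
    t / (1 - t) ≤ ρ / (1 - ρ) := by
  rw [div_le_div_iff₀ (by linarith) (by linarith)]
  nlinarith [htρ, hρ]

/-- **Mean-value defect of `log`**: on the ball `‖· − 1‖ ≤ ρ < 1` the series logarithm differs from the identity by a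
`ρ/(1 − ρ)`-Lipschitz map: `‖log A − log B − (A − B)‖ ≤ ρ/(1 − ρ) · ‖A − B‖` (mean-value inequality with the tree's
`‖D log(X) − id‖ ≤ ‖X − 1‖/(1 − ‖X − 1‖)`, `LogFDeriv.norm_tsum_term_sub_id_le`). [folklore] -/
theorem norm_mlog_sub_mlog_sub_le {ρ : ℝ} (hρ : ρ < 1) {A B : 𝔸} (hA : ‖A - 1‖ ≤ ρ) (hB : ‖B - 1‖ ≤ ρ) :
    ‖mlog A - mlog B - (A - B)‖ ≤ ρ / (1 - ρ) * ‖A - B‖ := by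
  have hs : Convex ℝ (closedBall (1 : 𝔸) ρ) := convex_closedBall _ _
  have hmem : ∀ {Z : 𝔸}, ‖Z - 1‖ ≤ ρ → Z ∈ closedBall (1 : 𝔸) ρ := fun h => by
    rwa [mem_closedBall, dist_eq_norm]
  have hmem' : ∀ {Z : 𝔸}, Z ∈ closedBall (1 : 𝔸) ρ → ‖Z - 1‖ ≤ ρ := fun h => by
    rwa [mem_closedBall, dist_eq_norm] at h
  have key := hs.norm_image_sub_le_of_norm_hasFDerivWithin_le'
    (f := (mlog : 𝔸 → 𝔸)) (φ := ContinuousLinearMap.id ℂ 𝔸)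
    (f' := fun Z : 𝔸 => ∑' k, LogFDeriv.term (Z - 1) k) (C := ρ / (1 - ρ))
    (fun Z hZ => (LogFDeriv.hasFDerivAt_logOnePlus_sub_one ((hmem' hZ).trans_lt hρ)).hasFDerivWithinAt)
    (fun Z hZ => (LogFDeriv.norm_tsum_term_sub_id_le ((hmem' hZ).trans_lt hρ)).trans
      (div_one_sub_le_div_one_sub (hmem' hZ) hρ))
    (hmem hB) (hmem hA)
  simpa only [ContinuousLinearMap.id_apply] using key

/-- Lipschitz bound for `log` on `‖· − 1‖ ≤ ρ < 1`: `‖log A − log B‖ ≤ (1 + ρ/(1 − ρ)) ‖A − B‖`. [folklore] -/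
theorem norm_mlog_sub_mlog_le {ρ : ℝ} (hρ : ρ < 1) {A B : 𝔸} (hA : ‖A - 1‖ ≤ ρ) (hB : ‖B - 1‖ ≤ ρ) :
    ‖mlog A - mlog B‖ ≤ (1 + ρ / (1 - ρ)) * ‖A - B‖ := by
  have h := norm_mlog_sub_mlog_sub_le hρ hA hB
  have h2 : ‖mlog A - mlog B‖ ≤ ‖mlog A - mlog B - (A - B)‖ + ‖A - B‖ := by
    have := norm_add_le (mlog A - mlog B - (A - B)) (A - B)
    rwa [sub_add_cancel] at this
  linarith

/-- Second-order bound `‖log A − (A − 1)‖ ≤ ‖A − 1‖² / (1 − ‖A − 1‖)` on `‖A − 1‖ < 1`. [folklore] -/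
theorem norm_mlog_sub_sub_one_le {A : 𝔸} (hA : ‖A - 1‖ < 1) :
    ‖mlog A - (A - 1)‖ ≤ ‖A - 1‖ / (1 - ‖A - 1‖) * ‖A - 1‖ := by
  have h := norm_mlog_sub_mlog_sub_le hA le_rfl (B := 1) (by simp)
  simpa using h

/-! ## 2. The left side of (0.10) as a map and its approximate linearity -/

omit [NormedAlgebra ℂ 𝔸] in
/-- **An element within `t < 1` of `1` is invertible with inverse within `t/(1 − t)` of `1`** (Neumann series;
`(1 − X)·X⁻¹ = X⁻¹ − 1`). [folklore] -/
theorem isUnit_and_norm_inverse_sub_one_le {X : 𝔸} {t : ℝ} (hX : ‖X - 1‖ ≤ t) (ht : t < 1) :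
    IsUnit X ∧ ‖Ring.inverse X - 1‖ ≤ t / (1 - t) := by
  have h1 : ‖1 - X‖ < 1 := by rw [norm_sub_rev]; exact hX.trans_lt ht
  have hu : IsUnit X := by
    have := (Units.oneSub (1 - X) h1).isUnit
    rwa [Units.val_oneSub, sub_sub_cancel] at this
  refine ⟨hu, ?_⟩
  have hXi : X * Ring.inverse X = 1 := Ring.mul_inverse_cancel X hu
  have hid : Ring.inverse X - 1 = (1 - X) * (Ring.inverse X - 1) + (1 - X) := by
    calc Ring.inverse X - 1 = Ring.inverse X - X * Ring.inverse X := by rw [hXi]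
      _ = (1 - X) * (Ring.inverse X - 1) + (1 - X) := by noncomm_ring
  have hle : ‖Ring.inverse X - 1‖ ≤ t * ‖Ring.inverse X - 1‖ + t := by
    have h2 : ‖(1 - X) * (Ring.inverse X - 1)‖ ≤ t * ‖Ring.inverse X - 1‖ :=
      (norm_mul_le _ _).trans (mul_le_mul_of_nonneg_right (by rwa [norm_sub_rev]) (norm_nonneg _))
    have h3 : ‖(1 : 𝔸) - X‖ ≤ t := by rwa [norm_sub_rev]
    calc ‖Ring.inverse X - 1‖ = ‖(1 - X) * (Ring.inverse X - 1) + (1 - X)‖ := by rw [← hid]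
      _ ≤ _ := (norm_add_le _ _).trans (add_le_add h2 h3)
  rw [le_div_iff₀ (by linarith)]
  nlinarith [norm_nonneg (Ring.inverse X - 1)]

/-- Equal exponentials of complex numbers of modulus `< π` have equal arguments. [folklore] -/
theorem cexp_inj_of_norm_lt_pi {z w : ℂ} (h : Complex.exp z = Complex.exp w) (hz : ‖z‖ < Real.pi)
    (hw : ‖w‖ < Real.pi) : z = w := by
  obtain ⟨k, hk⟩ := Complex.exp_eq_exp_iff_exists_int.1 h
  have hkz : (k : ℂ) * (2 * Real.pi * Complex.I) = z - w := by rw [hk]; ring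
  have hnorm : ‖(k : ℂ) * (2 * Real.pi * Complex.I)‖ < 2 * Real.pi := by
    rw [hkz]; exact (norm_sub_le _ _).trans_lt (by linarith)
  have hn : ‖(2 * Real.pi * Complex.I : ℂ)‖ = 2 * Real.pi := by simp [abs_of_pos Real.pi_pos]
  rw [norm_mul, hn, Complex.norm_intCast] at hnorm
  have hk1 : |(k : ℝ)| < 1 := by nlinarith [Real.pi_pos, abs_nonneg (k : ℝ)]
  have hk0 : k = 0 := by
    have : |k| < 1 := by exact_mod_cast hk1
    exact Int.abs_lt_one_iff.1 this
  rw [hk, hk0]; simp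

variable {ι : Type*} [Fintype ι]

/-- **The left side of (0.10), normalised**: `fed W X = |I|⁻¹ Σ_j log (W_j X)` — the unknown is `X = (M U₀⁻¹)⁻¹` after the
translation `U_j = W_j U₀` (so that `U_j M⁻¹ = W_j X`). [cite: Balaban1987RG1, (0.10) p.253] -/
def fed (W : ι → 𝔸) (X : 𝔸) : 𝔸 := (Fintype.card ι : ℂ)⁻¹ • ∑ j, mlog (W j * X)

omit [CompleteSpace 𝔸] in
/-- Unfolding `fed`. [folklore] -/
theorem fed_def (W : ι → 𝔸) (X : 𝔸) : fed W X = (Fintype.card ι : ℂ)⁻¹ • ∑ j, mlog (W j * X) := rfl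

omit [CompleteSpace 𝔸] in
/-- (0.7) at the level of the equation: `fed (W ∘ σ) = fed W`. [cite: Balaban1987RG1, (0.7) p.253] -/
theorem fed_comp_equiv (W : ι → 𝔸) (σ : Equiv.Perm ι) (X : 𝔸) : fed (W ∘ σ) X = fed W X := by
  simp only [fed_def, Function.comp_apply]
  congr 1
  exact Equiv.sum_comp σ (fun j => mlog (W j * X))

/-- (0.6) at the level of the equation: `fed (vWw) (vXw) = v (fed W X) w` for `vw = wv = 1`. [cite: Balaban1987RG1, (0.6) p.253] -/
theorem fed_conj {v w : 𝔸} (hvw : v * w = 1) (hwv : w * v = 1) (W : ι → 𝔸) (X : 𝔸) :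
    fed (fun j => v * W j * w) (v * X * w) = v * fed W X * w := by
  simp only [fed_def, Finset.mul_sum, Finset.sum_mul, smul_mul_assoc, mul_smul_comm]
  congr 1
  refine Finset.sum_congr rfl fun j _ => ?_
  rw [show v * W j * w * (v * X * w) = v * (W j * X) * w by
    rw [show v * W j * w * (v * X * w) = v * W j * (w * v) * X * w by noncomm_ring, hwv]; noncomm_ring]
  exact mlog_conj hvw hwv _

omit [NormedAlgebra ℂ 𝔸] [CompleteSpace 𝔸] in
/-- `W X − 1 = (W − 1)(X − 1) + (W − 1) + (X − 1)`. [folklore] -/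
theorem mul_sub_one_eq (W X : 𝔸) : W * X - 1 = (W - 1) * (X - 1) + (W - 1) + (X - 1) := by noncomm_ring

omit [NormedAlgebra ℂ 𝔸] [CompleteSpace 𝔸] in
/-- `‖W X − 1‖ ≤ δ R + δ + R` for `‖W − 1‖ ≤ δ`, `‖X − 1‖ ≤ R`. [folklore] -/
theorem norm_mul_sub_one_le {δ R : ℝ} {W X : 𝔸} (hW : ‖W - 1‖ ≤ δ) (hX : ‖X - 1‖ ≤ R) :
    ‖W * X - 1‖ ≤ δ * R + δ + R := by
  rw [mul_sub_one_eq]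
  have h1 : ‖(W - 1) * (X - 1)‖ ≤ δ * R :=
    (norm_mul_le _ _).trans (mul_le_mul hW hX (norm_nonneg _) ((norm_nonneg _).trans hW))
  exact (norm_add_le _ _).trans (add_le_add ((norm_add_le _ _).trans (add_le_add h1 hW)) hX)

omit [NormedAlgebra ℂ 𝔸] [CompleteSpace 𝔸] in
/-- `‖(W − 1) Y‖ ≤ δ (‖Y − 1‖ + 1)`-type bound without `‖1‖`: `‖(W − W') X‖ ≤ ‖W − W'‖ (R + 1)` for `‖X − 1‖ ≤ R`. [folklore] -/
theorem norm_sub_mul_le {R : ℝ} (D X : 𝔸) (hX : ‖X - 1‖ ≤ R) : ‖D * X‖ ≤ ‖D‖ * (R + 1) := by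
  have : D * X = D * (X - 1) + D := by noncomm_ring
  rw [this]
  refine (norm_add_le _ _).trans ?_
  have h1 : ‖D * (X - 1)‖ ≤ ‖D‖ * R := (norm_mul_le _ _).trans (mul_le_mul_of_nonneg_left hX (norm_nonneg _))
  nlinarith [norm_nonneg D]

omit [CompleteSpace 𝔸] in
/-- Norm of an average: if every `‖a_j‖ ≤ K` then `‖|I|⁻¹ Σ_j a_j‖ ≤ K`. [folklore] -/
theorem norm_avg_le [Nonempty ι] {a : ι → 𝔸} {K : ℝ} (h : ∀ j, ‖a j‖ ≤ K) :
    ‖(Fintype.card ι : ℂ)⁻¹ • ∑ j, a j‖ ≤ K := by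
  have hc : (0 : ℝ) < Fintype.card ι := Nat.cast_pos.mpr Fintype.card_pos
  rw [norm_smul, norm_inv, Complex.norm_natCast]
  have hs : ‖∑ j, a j‖ ≤ Fintype.card ι * K :=
    (norm_sum_le _ _).trans (by simpa using Finset.sum_le_sum fun j (_ : j ∈ Finset.univ) => h j)
  rw [inv_mul_le_iff₀ hc]
  exact hs

omit [CompleteSpace 𝔸] in
/-- `|I|⁻¹ Σ_j c = c`. [folklore] -/
theorem avg_const [Nonempty ι] (c : 𝔸) : (Fintype.card ι : ℂ)⁻¹ • ∑ _j : ι, c = c := by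
  have hc : (Fintype.card ι : ℂ) ≠ 0 := Nat.cast_ne_zero.mpr Fintype.card_ne_zero
  rw [Finset.sum_const, Finset.card_univ, ← Nat.cast_smul_eq_nsmul ℂ, smul_smul, inv_mul_cancel₀ hc, one_smul]

/-- **Approximate linearity of (0.10) in the unknown**, uniformly in the arity: for `‖W_j − 1‖ ≤ δ` and `X, Y` in the ball
`‖· − 1‖ ≤ R` with `ρ = δR + δ + R < 1`,
`‖fed W X − fed W Y − (X − Y)‖ ≤ (ρ/(1 − ρ)·(1 + δ) + δ) ‖X − Y‖` (termwise: the mean-value defect of `log` at `W_j X`,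
`W_j Y`, plus `(W_j − 1)(X − Y)`; the average of termwise bounds is the same bound — this is where arity-uniformity comes
from). [folklore] -/
theorem norm_fed_sub_fed_sub_le [Nonempty ι] {δ R : ℝ} {W : ι → 𝔸} (hW : ∀ j, ‖W j - 1‖ ≤ δ)
    (hρ : δ * R + δ + R < 1) {X Y : 𝔸} (hX : ‖X - 1‖ ≤ R) (hY : ‖Y - 1‖ ≤ R) :
    ‖fed W X - fed W Y - (X - Y)‖
      ≤ ((δ * R + δ + R) / (1 - (δ * R + δ + R)) * (1 + δ) + δ) * ‖X - Y‖ := by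
  set ρ := δ * R + δ + R with hρ_def
  have hδ0 : 0 ≤ δ := (norm_nonneg _).trans (hW (Classical.arbitrary ι))
  have hc0 : 0 ≤ ρ / (1 - ρ) := div_nonneg (by nlinarith [(norm_nonneg _).trans hX]) (by linarith)
  have hsplit : fed W X - fed W Y - (X - Y)
      = (Fintype.card ι : ℂ)⁻¹ • ∑ j, (mlog (W j * X) - mlog (W j * Y) - (X - Y)) := by
    conv_lhs => rw [← avg_const (ι := ι) (X - Y)]
    simp only [fed_def, ← smul_sub, ← Finset.sum_sub_distrib]
  rw [hsplit]
  refine norm_avg_le fun j => ?_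
  have hA : ‖W j * X - 1‖ ≤ ρ := norm_mul_sub_one_le (hW j) hX
  have hB : ‖W j * Y - 1‖ ≤ ρ := norm_mul_sub_one_le (hW j) hY
  have h1 := norm_mlog_sub_mlog_sub_le hρ hA hB
  have h2 : ‖W j * X - W j * Y‖ ≤ (1 + δ) * ‖X - Y‖ := by
    rw [← mul_sub, show W j * (X - Y) = (W j - 1) * (X - Y) + (X - Y) by noncomm_ring]
    refine (norm_add_le _ _).trans ?_
    have := (norm_mul_le (W j - 1) (X - Y)).trans (mul_le_mul_of_nonneg_right (hW j) (norm_nonneg _))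
    linarith
  have h3 : ‖(W j - 1) * (X - Y)‖ ≤ δ * ‖X - Y‖ :=
    (norm_mul_le _ _).trans (mul_le_mul_of_nonneg_right (hW j) (norm_nonneg _))
  have hid : mlog (W j * X) - mlog (W j * Y) - (X - Y)
      = (mlog (W j * X) - mlog (W j * Y) - (W j * X - W j * Y)) + (W j - 1) * (X - Y) := by noncomm_ring
  rw [hid]
  refine (norm_add_le _ _).trans ?_
  have h4 : ρ / (1 - ρ) * ‖W j * X - W j * Y‖ ≤ ρ / (1 - ρ) * ((1 + δ) * ‖X - Y‖) :=
    mul_le_mul_of_nonneg_left h2 hc0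
  nlinarith

/-- The numerical instance used below: `δ ≤ 1/100`, `R = 2/25` give a constant `≤ 1/6`. [folklore] -/
theorem fed_const_le {δ : ℝ} (hδ0 : 0 ≤ δ) (hδ : δ ≤ 1 / 100) :
    (δ * (2 / 25) + δ + 2 / 25) / (1 - (δ * (2 / 25) + δ + 2 / 25)) * (1 + δ) + δ ≤ 1 / 6 := by
  have hρ : δ * (2 / 25) + δ + 2 / 25 ≤ 1 / 10 := by nlinarith
  have h1 : (δ * (2 / 25) + δ + 2 / 25) / (1 - (δ * (2 / 25) + δ + 2 / 25)) ≤ 1 / 9 := by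
    rw [div_le_iff₀ (by nlinarith)]; nlinarith
  nlinarith [mul_le_mul h1 (show 1 + δ ≤ 101 / 100 by linarith) (by linarith) (by norm_num)]

/-- **(0.10) approximates the identity** on the ball `‖X − 1‖ ≤ 2/25` with constant `1/6`, for every family with
`‖W_j − 1‖ ≤ 1/100` (Mathlib's `ApproximatesLinearOn`, the quantitative inverse-function set-up). [folklore] -/
theorem approximatesLinearOn_fed [Nonempty ι] {W : ι → 𝔸} (hW : ∀ j, ‖W j - 1‖ ≤ 1 / 100) :
    ApproximatesLinearOn (fed W) ((ContinuousLinearEquiv.refl ℂ 𝔸 : 𝔸 ≃L[ℂ] 𝔸) : 𝔸 →L[ℂ] 𝔸)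
      (closedBall (1 : 𝔸) (2 / 25)) (1 / 6 : ℝ≥0) := by
  intro X hX Y hY
  rw [mem_closedBall, dist_eq_norm] at hX hY
  have h := norm_fed_sub_fed_sub_le hW (R := 2 / 25) (by norm_num) hX hY
  have hc := fed_const_le (δ := 1 / 100) (by norm_num) le_rfl
  have : ((1 / 6 : ℝ≥0) : ℝ) = 1 / 6 := by norm_num
  simp only [this, ContinuousLinearEquiv.coe_coe, ContinuousLinearEquiv.refl_apply]
  exact h.trans (mul_le_mul_of_nonneg_right hc (norm_nonneg _))

/-- `‖fed W 1‖ ≤ 2δ` for `‖W_j − 1‖ ≤ δ ≤ 1/2` (B7 (26): `‖log W‖ ≤ 2‖W − 1‖`). [folklore] -/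
theorem norm_fed_one_le [Nonempty ι] {δ : ℝ} (hδ : δ ≤ 1 / 2) {W : ι → 𝔸} (hW : ∀ j, ‖W j - 1‖ ≤ δ) :
    ‖fed W 1‖ ≤ 2 * δ := by
  rw [fed_def]
  refine norm_avg_le fun j => ?_
  rw [mul_one]
  exact (norm_mlog_le_two_mul ((hW j).trans hδ)).trans (by linarith [hW j])

/-- **Existence for (0.10)**, quantitative and arity-uniform: for `‖W_j − 1‖ ≤ δ ≤ 1/100` there is a solution `X` of
`Σ_j log (W_j X) = 0` with `‖X − 1‖ ≤ 3δ` (local surjectivity of a map approximating the identity,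
`ApproximatesLinearOn.surjOn_closedBall_of_nonlinearRightInverse`: the image of the ball of radius `3δ` contains the ball of
radius `(5/6)·3δ ≥ 2δ ≥ ‖fed W 1‖` about `fed W 1`). [folklore] -/
theorem exists_fed_eq_zero [Nonempty ι] {δ : ℝ} (hδ : δ ≤ 1 / 100) {W : ι → 𝔸} (hW : ∀ j, ‖W j - 1‖ ≤ δ) :
    ∃ X : 𝔸, ‖X - 1‖ ≤ 3 * δ ∧ fed W X = 0 := by
  have hδ0 : 0 ≤ δ := (norm_nonneg _).trans (hW (Classical.arbitrary ι))
  rcases subsingleton_or_nontrivial 𝔸 with h𝔸 | h𝔸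
  · exact ⟨1, by simp; positivity, Subsingleton.elim _ _⟩
  have hf := approximatesLinearOn_fed (fun j => (hW j).trans hδ)
  set e : 𝔸 ≃L[ℂ] 𝔸 := ContinuousLinearEquiv.refl ℂ 𝔸
  have hsurj := hf.surjOn_closedBall_of_nonlinearRightInverse e.toNonlinearRightInverse (ε := 3 * δ) (b := 1)
    (by positivity) (closedBall_subset_closedBall (by linarith))
  have hnn : (e.toNonlinearRightInverse.nnnorm : ℝ) = 1 := by
    show ‖((e.symm : 𝔸 ≃L[ℂ] 𝔸) : 𝔸 →L[ℂ] 𝔸)‖ = 1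
    simp [e]
  rw [hnn] at hsurj
  have h0 : (0 : 𝔸) ∈ closedBall (fed W 1) ((1⁻¹ - ((1 / 6 : ℝ≥0) : ℝ)) * (3 * δ)) := by
    rw [mem_closedBall, dist_comm, dist_zero_right]
    have := norm_fed_one_le (hδ.trans (by norm_num)) hW
    have h16 : ((1 / 6 : ℝ≥0) : ℝ) = 1 / 6 := by norm_num
    rw [h16]; linarith
  obtain ⟨X, hX, hfX⟩ := hsurj h0
  rw [mem_closedBall, dist_eq_norm] at hX
  exact ⟨X, hX, hfX⟩

/-- **Uniqueness for (0.10)** in the fixed ball `‖X − 1‖ ≤ 2/25`: `fed W` is injective there (for `‖W_j − 1‖ ≤ 1/100`).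
[folklore] -/
theorem injOn_fed [Nonempty ι] {W : ι → 𝔸} (hW : ∀ j, ‖W j - 1‖ ≤ 1 / 100) :
    InjOn (fed W) (closedBall (1 : 𝔸) (2 / 25)) := by
  rcases subsingleton_or_nontrivial 𝔸 with h𝔸 | h𝔸
  · exact fun X _ Y _ _ => Subsingleton.elim _ _
  refine (approximatesLinearOn_fed hW).injOn (Or.inr ?_)
  have : ‖(((ContinuousLinearEquiv.refl ℂ 𝔸).symm : 𝔸 ≃L[ℂ] 𝔸) : 𝔸 →L[ℂ] 𝔸)‖₊ = 1 := by
    rw [← NNReal.coe_inj]; simp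
  rw [this, inv_one]
  rw [show (1 / 6 : ℝ≥0) = 6⁻¹ by rw [one_div]]
  exact inv_lt_one_of_one_lt₀ (by norm_num)


/-! ## 2b. The local solution `X(W)` of (0.10): definition, uniqueness, size, Lipschitz dependence -/

section Sol

variable [Nonempty ι]

/-- **The local solution of (0.10)**: for a family with `‖W_j − 1‖ ≤ 1/100`, `fedSol W` is a solution `X` of
`Σ_j log (W_j X) = 0` with `‖X − 1‖ ≤ 3/100` (chosen by `exists_fed_eq_zero`; unique in `‖X − 1‖ ≤ 2/25` by `injOn_fed`);
`1` off that domain. [cite: Balaban1987RG1, (0.10) p.253] -/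
def fedSol (W : ι → 𝔸) : 𝔸 :=
  if h : ∀ j, ‖W j - 1‖ ≤ 1 / 100 then Classical.choose (exists_fed_eq_zero le_rfl h) else 1

/-- The defining properties of `fedSol W` on the domain. [folklore] -/
theorem fedSol_spec {W : ι → 𝔸} (h : ∀ j, ‖W j - 1‖ ≤ 1 / 100) :
    ‖fedSol W - 1‖ ≤ 3 / 100 ∧ fed W (fedSol W) = 0 := by
  rw [fedSol, dif_pos h]
  have := Classical.choose_spec (exists_fed_eq_zero (le_refl (1 / 100 : ℝ)) h)
  exact ⟨this.1.trans (by norm_num), this.2⟩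

/-- **`fedSol W` solves (0.10)**: `|I|⁻¹ Σ_j log (W_j · fedSol W) = 0`. [cite: Balaban1987RG1, (0.10) p.253] -/
theorem fed_fedSol {W : ι → 𝔸} (h : ∀ j, ‖W j - 1‖ ≤ 1 / 100) : fed W (fedSol W) = 0 := (fedSol_spec h).2

/-- The un-normalised form: `Σ_j log (W_j · fedSol W) = 0`. [cite: Balaban1987RG1, (0.10) p.253] -/
theorem sum_mlog_mul_fedSol {W : ι → 𝔸} (h : ∀ j, ‖W j - 1‖ ≤ 1 / 100) : ∑ j, mlog (W j * fedSol W) = 0 := by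
  have h1 := fed_fedSol h
  have hc : (Fintype.card ι : ℂ)⁻¹ ≠ 0 := inv_ne_zero (Nat.cast_ne_zero.mpr Fintype.card_ne_zero)
  rwa [fed_def, smul_eq_zero, or_iff_right hc] at h1

/-- Off the domain `fedSol W = 1`. [folklore] -/
theorem fedSol_of_not {W : ι → 𝔸} (h : ¬ ∀ j, ‖W j - 1‖ ≤ 1 / 100) : fedSol W = 1 := by
  rw [fedSol, dif_neg h]

/-- **Local uniqueness for (0.10)**: any solution `Y` of `fed W Y = 0` with `‖Y − 1‖ ≤ 2/25` IS `fedSol W`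
(`‖W_j − 1‖ ≤ 1/100`). [folklore] -/
theorem fedSol_unique {W : ι → 𝔸} (hW : ∀ j, ‖W j - 1‖ ≤ 1 / 100) {Y : 𝔸} (hY : ‖Y - 1‖ ≤ 2 / 25)
    (hfY : fed W Y = 0) : Y = fedSol W := by
  have hs := fedSol_spec hW
  refine injOn_fed hW (by rwa [mem_closedBall, dist_eq_norm]) (by
    rw [mem_closedBall, dist_eq_norm]; exact hs.1.trans (by norm_num)) ?_
  rw [hfY, hs.2]

/-- **The solution is `3δ`-close to `1`** for a `δ`-small family (`δ ≤ 1/100`): the `3δ`-close solution of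
`exists_fed_eq_zero` is `fedSol W` by uniqueness. [folklore] -/
theorem norm_fedSol_sub_one_le {δ : ℝ} (hδ : δ ≤ 1 / 100) {W : ι → 𝔸} (hW : ∀ j, ‖W j - 1‖ ≤ δ) :
    ‖fedSol W - 1‖ ≤ 3 * δ := by
  obtain ⟨X, hX, hfX⟩ := exists_fed_eq_zero hδ hW
  have hW' : ∀ j, ‖W j - 1‖ ≤ 1 / 100 := fun j => (hW j).trans hδ
  rw [← fedSol_unique hW' (hX.trans (by linarith)) hfX]
  exact hX

/-- `fedSol` of the constant family `1` is `1` (so the average of a constant family `{U, …, U}` will be `U`). [folklore] -/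
theorem fedSol_const_one : fedSol (fun _ : ι => (1 : 𝔸)) = 1 := by
  symm
  refine fedSol_unique (fun _ => by simp) (by norm_num) ?_
  simp [fed_def]

/-- **(0.7) for the solution**: `fedSol (W ∘ σ) = fedSol W`. [cite: Balaban1987RG1, (0.7) p.253] -/
theorem fedSol_comp_equiv {W : ι → 𝔸} (hW : ∀ j, ‖W j - 1‖ ≤ 1 / 100) (σ : Equiv.Perm ι) :
    fedSol (W ∘ σ) = fedSol W := by
  symm
  refine fedSol_unique (fun j => hW (σ j)) ((fedSol_spec hW).1.trans (by norm_num)) ?_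
  exact (fed_comp_equiv W σ (fedSol W)).trans (fed_fedSol hW)

/-- **(0.6) for the solution, conjugations**: `fedSol (vWw) = v (fedSol W) w` for `vw = wv = 1`, provided conjugation by
`v` does not move `‖· − 1‖` on the relevant elements (an isometry hypothesis, true for unitary `v` in a `C⋆`-norm).
[cite: Balaban1987RG1, (0.6) p.253] -/
theorem fedSol_conj {v w : 𝔸} (hvw : v * w = 1) (hwv : w * v = 1)
    (hiso : ∀ X : 𝔸, ‖v * X * w - 1‖ = ‖X - 1‖) {W : ι → 𝔸} (hW : ∀ j, ‖W j - 1‖ ≤ 1 / 100) :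
    fedSol (fun j => v * W j * w) = v * fedSol W * w := by
  symm
  have hW' : ∀ j, ‖v * W j * w - 1‖ ≤ 1 / 100 := fun j => by rw [hiso]; exact hW j
  refine fedSol_unique hW' (by rw [hiso]; exact (fedSol_spec hW).1.trans (by norm_num)) ?_
  rw [fed_conj hvw hwv, fed_fedSol hW, mul_zero, zero_mul]

/-- Lipschitz dependence of (0.10) on the family at a fixed unknown `Y` with `‖Y − 1‖ ≤ 3/100`:
`‖fed W Y − fed W' Y‖ ≤ (10/9)(103/100) ‖W − W'‖` (sup norm on families). [folklore] -/
theorem norm_fed_sub_fed_le_of_family {W W' : ι → 𝔸} (hW : ∀ j, ‖W j - 1‖ ≤ 1 / 100)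
    (hW' : ∀ j, ‖W' j - 1‖ ≤ 1 / 100) {Y : 𝔸} (hY : ‖Y - 1‖ ≤ 3 / 100) :
    ‖fed W Y - fed W' Y‖ ≤ 10 / 9 * (103 / 100) * ‖W - W'‖ := by
  have hsplit : fed W Y - fed W' Y = (Fintype.card ι : ℂ)⁻¹ • ∑ j, (mlog (W j * Y) - mlog (W' j * Y)) := by
    simp only [fed_def, ← smul_sub, ← Finset.sum_sub_distrib]
  rw [hsplit]
  refine norm_avg_le fun j => ?_
  have hA : ‖W j * Y - 1‖ ≤ 1 / 10 := (norm_mul_sub_one_le (hW j) hY).trans (by norm_num)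
  have hB : ‖W' j * Y - 1‖ ≤ 1 / 10 := (norm_mul_sub_one_le (hW' j) hY).trans (by norm_num)
  have h1 := norm_mlog_sub_mlog_le (by norm_num : (1 / 10 : ℝ) < 1) hA hB
  have h2 : ‖W j * Y - W' j * Y‖ ≤ ‖W j - W' j‖ * (3 / 100 + 1) := by
    rw [← sub_mul]; exact norm_sub_mul_le _ _ hY
  have h3 : ‖W j - W' j‖ ≤ ‖W - W'‖ := by simpa using norm_le_pi_norm (W - W') j
  have h4 : ‖W j * Y - W' j * Y‖ ≤ ‖W - W'‖ * (3 / 100 + 1) :=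
    h2.trans (mul_le_mul_of_nonneg_right h3 (by norm_num))
  calc ‖mlog (W j * Y) - mlog (W' j * Y)‖ ≤ (1 + 1 / 10 / (1 - 1 / 10)) * ‖W j * Y - W' j * Y‖ := h1
    _ ≤ (1 + 1 / 10 / (1 - 1 / 10)) * (‖W - W'‖ * (3 / 100 + 1)) :=
        mul_le_mul_of_nonneg_left h4 (by norm_num)
    _ = 10 / 9 * (103 / 100) * ‖W - W'‖ := by ring

/-- **Lipschitz dependence of the solution on the family** (sup norm): `‖fedSol W − fedSol W'‖ ≤ 2 ‖W − W'‖` for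
`‖W_j − 1‖, ‖W'_j − 1‖ ≤ 1/100` (the map is `1/6`-approximately the identity in the unknown and Lipschitz in the family).
[folklore] -/
theorem norm_fedSol_sub_fedSol_le {W W' : ι → 𝔸} (hW : ∀ j, ‖W j - 1‖ ≤ 1 / 100)
    (hW' : ∀ j, ‖W' j - 1‖ ≤ 1 / 100) : ‖fedSol W - fedSol W'‖ ≤ 2 * ‖W - W'‖ := by
  have hX : ‖fedSol W - 1‖ ≤ 3 / 100 := (fedSol_spec hW).1
  have hX' : ‖fedSol W' - 1‖ ≤ 3 / 100 := (fedSol_spec hW').1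
  have happ := norm_fed_sub_fed_sub_le hW (R := 3 / 100) (by norm_num) hX hX'
  have hK : ((1 / 100 : ℝ) * (3 / 100) + 1 / 100 + 3 / 100) / (1 - ((1 / 100 : ℝ) * (3 / 100) + 1 / 100 + 3 / 100))
      * (1 + 1 / 100) + 1 / 100 ≤ 1 / 6 := by norm_num
  have hA : ‖fed W (fedSol W) - fed W (fedSol W') - (fedSol W - fedSol W')‖ ≤ 1 / 6 * ‖fedSol W - fedSol W'‖ :=
    happ.trans (mul_le_mul_of_nonneg_right hK (norm_nonneg _))
  have hB : ‖fedSol W - fedSol W'‖ ≤ ‖fed W (fedSol W) - fed W (fedSol W')‖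
      + ‖fed W (fedSol W) - fed W (fedSol W') - (fedSol W - fedSol W')‖ := by
    have := norm_sub_le (fed W (fedSol W) - fed W (fedSol W'))
      (fed W (fedSol W) - fed W (fedSol W') - (fedSol W - fedSol W'))
    rwa [sub_sub_cancel] at this
  have hC : ‖fed W (fedSol W) - fed W (fedSol W')‖ ≤ 10 / 9 * (103 / 100) * ‖W - W'‖ := by
    rw [fed_fedSol hW, zero_sub, norm_neg,
      show fed W (fedSol W') = fed W (fedSol W') - fed W' (fedSol W') by rw [fed_fedSol hW', sub_zero]]
    exact norm_fed_sub_fed_le_of_family hW hW' hX'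
  nlinarith [norm_nonneg (W - W'), norm_nonneg (fedSol W - fedSol W')]

/-- The open set of `δ`-small families `{W | ∀ j, ‖W_j − 1‖ < δ}` (the tree's `ExpMeanLog.smallFamilies`) lies in the
domain of `fedSol` for `δ ≤ 1/100`, and **`fedSol` is continuous there** (Lipschitz). [folklore] -/
theorem continuousOn_fedSol : ContinuousOn (fedSol : (ι → 𝔸) → 𝔸) (smallFamilies ι 𝔸 (1 / 100)) := by
  have hL : LipschitzOnWith 2 (fedSol : (ι → 𝔸) → 𝔸) {W | ∀ j, ‖W j - 1‖ ≤ 1 / 100} := by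
    refine LipschitzOnWith.of_dist_le_mul fun W hW W' hW' => ?_
    rw [dist_eq_norm, dist_eq_norm]
    exact_mod_cast norm_fedSol_sub_fedSol_le hW hW'
  exact hL.continuousOn.mono fun W hW j => le_of_lt (hW j)

/-- `t ↦ t²/(1 − t)`-type bound transported along `t ≤ s < 1`: `‖log A − (A − 1)‖ ≤ s²/(1 − s)` for `‖A − 1‖ ≤ s`.
[folklore] -/
theorem norm_mlog_sub_sub_one_le_of_le {A : 𝔸} {s : ℝ} (hA : ‖A - 1‖ ≤ s) (hs : s < 1) :
    ‖mlog A - (A - 1)‖ ≤ s / (1 - s) * s := by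
  have hs0 : 0 ≤ s := (norm_nonneg _).trans hA
  exact (norm_mlog_sub_sub_one_le (hA.trans_lt hs)).trans
    (mul_le_mul (div_one_sub_le_div_one_sub hA hs) hA (norm_nonneg _) (div_nonneg hs0 (by linarith)))

omit [CompleteSpace 𝔸] in
/-- The second-order identity behind (0.8): `log (WX) − log W − log X = [log (WX) − (WX − 1)] − [log W − (W − 1)] −
[log X − (X − 1)] + (W − 1)(X − 1)`. [folklore] -/
theorem mlog_mul_sub_sub_eq (W X : 𝔸) : mlog (W * X) - mlog W - mlog X
    = (mlog (W * X) - (W * X - 1)) - (mlog W - (W - 1)) - (mlog X - (X - 1)) + (W - 1) * (X - 1) := by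
  noncomm_ring

/-- **(0.8) for Federbush's mean, quantitative: the first-order term is the arithmetic mean of the Lie-algebra
elements.**  For `‖W_j − 1‖ ≤ δ ≤ 1/100` the solution `X = fedSol W` of (0.10) satisfies
`‖log X + |I|⁻¹ Σ_j log W_j‖ ≤ 35 δ²`; since the mean is `M = X⁻¹ U₀`, this reads `(1/i) log (M U₀⁻¹) =
|I|⁻¹ Σ_j (1/i) log (U_j U₀⁻¹) + O(δ²)` with the FILE's constant `35` (print: "(higher order terms)").
[cite: Balaban1987RG1, (0.8) p.253] -/
theorem norm_mlog_fedSol_add_fed_one_le {δ : ℝ} (hδ : δ ≤ 1 / 100) {W : ι → 𝔸} (hW : ∀ j, ‖W j - 1‖ ≤ δ) :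
    ‖mlog (fedSol W) + fed W 1‖ ≤ 35 * δ ^ 2 := by
  have hδ0 : 0 ≤ δ := (norm_nonneg _).trans (hW (Classical.arbitrary ι))
  have hW' : ∀ j, ‖W j - 1‖ ≤ 1 / 100 := fun j => (hW j).trans hδ
  have hX : ‖fedSol W - 1‖ ≤ 3 * δ := norm_fedSol_sub_one_le hδ hW
  -- `0 = fed W X = |I|⁻¹ Σ_j log (W_j X)`, `fed W 1 = |I|⁻¹ Σ_j log W_j`, `log X = |I|⁻¹ Σ_j log X`
  have hid : mlog (fedSol W) + fed W 1
      = -((Fintype.card ι : ℂ)⁻¹ • ∑ j, (mlog (W j * fedSol W) - mlog (W j) - mlog (fedSol W))) := by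
    have h0 : (Fintype.card ι : ℂ)⁻¹ • ∑ j, mlog (W j * fedSol W) = 0 := fed_fedSol hW'
    simp only [Finset.sum_sub_distrib, smul_sub, h0, avg_const, fed_def, mul_one]
    abel
  rw [hid, norm_neg]
  refine norm_avg_le fun j => ?_
  rw [mlog_mul_sub_sub_eq]
  have hA : ‖W j * fedSol W - 1‖ ≤ 403 / 100 * δ := (norm_mul_sub_one_le (hW j) hX).trans (by nlinarith)
  have h1 : ‖mlog (W j * fedSol W) - (W j * fedSol W - 1)‖ ≤ 403 / 100 * δ / (1 - 403 / 100 * δ) * (403 / 100 * δ) :=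
    norm_mlog_sub_sub_one_le_of_le hA (by nlinarith)
  have h2 : ‖mlog (W j) - (W j - 1)‖ ≤ δ / (1 - δ) * δ := norm_mlog_sub_sub_one_le_of_le (hW j) (by linarith)
  have h3 : ‖mlog (fedSol W) - (fedSol W - 1)‖ ≤ 3 * δ / (1 - 3 * δ) * (3 * δ) :=
    norm_mlog_sub_sub_one_le_of_le hX (by linarith)
  have h4 : ‖(W j - 1) * (fedSol W - 1)‖ ≤ δ * (3 * δ) :=
    (norm_mul_le _ _).trans (mul_le_mul (hW j) hX (norm_nonneg _) hδ0)
  -- numerical bounds on the three fractions (`δ ≤ 1/100`)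
  have h1' : 403 / 100 * δ / (1 - 403 / 100 * δ) * (403 / 100 * δ) ≤ 20 * δ ^ 2 := by
    rw [div_mul_eq_mul_div, div_le_iff₀ (by nlinarith)]; nlinarith
  have h2' : δ / (1 - δ) * δ ≤ 2 * δ ^ 2 := by
    rw [div_mul_eq_mul_div, div_le_iff₀ (by nlinarith)]; nlinarith
  have h3' : 3 * δ / (1 - 3 * δ) * (3 * δ) ≤ 10 * δ ^ 2 := by
    rw [div_mul_eq_mul_div, div_le_iff₀ (by nlinarith)]; nlinarith
  calc ‖mlog (W j * fedSol W) - (W j * fedSol W - 1) - (mlog (W j) - (W j - 1)) - (mlog (fedSol W) - (fedSol W - 1))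
        + (W j - 1) * (fedSol W - 1)‖
      ≤ ‖mlog (W j * fedSol W) - (W j * fedSol W - 1)‖ + ‖mlog (W j) - (W j - 1)‖
        + ‖mlog (fedSol W) - (fedSol W - 1)‖ + ‖(W j - 1) * (fedSol W - 1)‖ := by
        refine (norm_add_le _ _).trans (add_le_add ((norm_sub_le _ _).trans (add_le_add (norm_sub_le _ _) le_rfl)) le_rfl)
    _ ≤ 35 * δ ^ 2 := by nlinarith

end Sol

end Banach

/-! ## 3. Unitary matrix families: the solution is unitary and, on `SU(N)`-families of radius `∝ 1/N`, special -/

section Unitary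

open scoped Matrix.Norms.L2Operator
open B7BlockAvgLog (mlog_exp)
open Literature.Analysis.Matrix (det_exp_eq_exp_trace)

variable {n : Type*} [Fintype n] [DecidableEq n]
variable {ι : Type*} [Fintype ι] [Nonempty ι]

/-- `log X* = (log X)*` for `‖X − 1‖ ≤ 1/3` (`X* = (e^{log X})* = e^{(log X)*}`, `‖(log X)*‖ < ln 2`, `mlog_exp`).
[folklore] -/
theorem mlog_star {X : Matrix n n ℂ} (hX : ‖X - 1‖ ≤ 1 / 3) : mlog (star X) = star (mlog X) := by
  letI : NormedAlgebra ℚ (Matrix n n ℂ) := NormedAlgebra.restrictScalars ℚ ℂ _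
  have hX1 : ‖X - 1‖ < 1 := lt_of_le_of_lt hX (by norm_num)
  have h2 : star X = exp (star (mlog X)) := by rw [← star_exp, exp_mlog hX1]
  rw [h2]
  exact mlog_exp (by
    rw [Matrix.star_eq_conjTranspose, Matrix.l2_opNorm_conjTranspose]; exact norm_mlog_lt_log_two hX)

/-- **(0.9) on `U(N)`: the solution of (0.10) for a unitary family is unitary.**  With `X = fedSol W` and
`X⁻¹` its (Neumann) inverse, `Y = (X⁻¹)*` also solves (0.10) in the uniqueness ball — `log (W_j (X⁻¹)*) =
(log (X⁻¹ W_j*))* = −(log (W_j X))*` by `log Y = −log X` for `XY = 1` — so `Y = X`, i.e. `X* X = 1`.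
[cite: Balaban1987RG1, (0.9) p.253] -/
theorem fedSol_mem_unitaryGroup {W : ι → Matrix n n ℂ} (hWu : ∀ j, W j ∈ Matrix.unitaryGroup n ℂ)
    (hW : ∀ j, ‖W j - 1‖ ≤ 1 / 100) : fedSol W ∈ Matrix.unitaryGroup n ℂ := by
  have hX : ‖fedSol W - 1‖ ≤ 3 / 100 := (fedSol_spec hW).1
  obtain ⟨hu, hinv⟩ := isUnit_and_norm_inverse_sub_one_le hX (by norm_num)
  have hXXi : fedSol W * Ring.inverse (fedSol W) = 1 := Ring.mul_inverse_cancel _ hu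
  have hXi1 : ‖Ring.inverse (fedSol W) - 1‖ ≤ 1 / 25 := hinv.trans (by norm_num)
  have hY1 : ‖star (Ring.inverse (fedSol W)) - 1‖ ≤ 2 / 25 := by rw [norm_star_sub_one]; linarith
  have hterm : ∀ j, mlog (W j * star (Ring.inverse (fedSol W))) = -star (mlog (W j * fedSol W)) := by
    intro j
    have hWX : ‖W j * fedSol W - 1‖ ≤ 1 / 3 := (norm_mul_sub_one_le (hW j) hX).trans (by norm_num)
    have hprod : W j * fedSol W * (Ring.inverse (fedSol W) * star (W j)) = 1 := by
      calc W j * fedSol W * (Ring.inverse (fedSol W) * star (W j))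
          = W j * (fedSol W * Ring.inverse (fedSol W)) * star (W j) := by noncomm_ring
        _ = 1 := by rw [hXXi, mul_one]; exact Matrix.mem_unitaryGroup_iff.1 (hWu j)
    have h1 : mlog (Ring.inverse (fedSol W) * star (W j)) = -mlog (W j * fedSol W) :=
      mlog_eq_neg_of_mul_eq_one hprod hWX
    have hWj : ‖star (W j) - 1‖ ≤ 1 / 100 := by rw [norm_star_sub_one]; exact hW j
    have hsmall : ‖Ring.inverse (fedSol W) * star (W j) - 1‖ ≤ 1 / 3 :=
      (norm_mul_sub_one_le hXi1 hWj).trans (by norm_num)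
    calc mlog (W j * star (Ring.inverse (fedSol W)))
        = mlog (star (Ring.inverse (fedSol W) * star (W j))) := by rw [star_mul, star_star]
      _ = star (mlog (Ring.inverse (fedSol W) * star (W j))) := mlog_star hsmall
      _ = -star (mlog (W j * fedSol W)) := by rw [h1, star_neg]
  have hfY : fed W (star (Ring.inverse (fedSol W))) = 0 := by
    have h0 := sum_mlog_mul_fedSol hW
    rw [fed_def]
    simp only [hterm, Finset.sum_neg_distrib, ← star_sum, h0, star_zero, neg_zero, smul_zero]
  have hYeq : star (Ring.inverse (fedSol W)) = fedSol W := fedSol_unique hW hY1 hfY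
  rw [Matrix.mem_unitaryGroup_iff, ← hYeq, star_star, hYeq]
  exact hXXi

/-- **(0.9) on `SU(N)`: the solution of (0.10) for an `SU(N)`-family of radius `δ ≤ min(1/100, 1/(3N))` has
determinant one.**  `z_j = tr log (W_j X)` all satisfy `e^{z_j} = det W_j · det X = det X` and `|z_j| ≤ 2N‖W_j X − 1‖
< π`, so they are equal; their sum is `tr Σ_j log (W_j X) = 0`; hence `z_j = 0` and `det X = e^0 = 1`.  The radius
`∝ 1/N` cannot be dispensed with (for `W = {e^{2πi/N}·1, 1}` the implicit mean is `e^{iπ/N}·1`, of determinant `−1`).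
[cite: Balaban1987RG1, (0.9) p.253] -/
theorem det_fedSol_eq_one {δ : ℝ} (hδ : δ ≤ 1 / 100) (hδN : (Fintype.card n : ℝ) * δ ≤ 1 / 3)
    {W : ι → Matrix n n ℂ} (hWs : ∀ j, W j ∈ Matrix.specialUnitaryGroup n ℂ) (hW : ∀ j, ‖W j - 1‖ ≤ δ) :
    (fedSol W).det = 1 := by
  letI : NormedAlgebra ℚ (Matrix n n ℂ) := NormedAlgebra.restrictScalars ℚ ℂ _
  have hδ0 : 0 ≤ δ := (norm_nonneg _).trans (hW (Classical.arbitrary ι))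
  have hW' : ∀ j, ‖W j - 1‖ ≤ 1 / 100 := fun j => (hW j).trans hδ
  have hX : ‖fedSol W - 1‖ ≤ 3 * δ := norm_fedSol_sub_one_le hδ hW
  -- the logarithms `z_j = tr log (W_j X)`
  have hA : ∀ j, ‖W j * fedSol W - 1‖ ≤ 403 / 100 * δ := fun j =>
    (norm_mul_sub_one_le (hW j) hX).trans (by nlinarith)
  have hA1 : ∀ j, ‖W j * fedSol W - 1‖ < 1 := fun j => (hA j).trans_lt (by nlinarith)
  have hz : ∀ j, ‖(mlog (W j * fedSol W)).trace‖ < Real.pi := by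
    intro j
    -- `|tr A| ≤ N‖A‖` (B7 (20): the tree's `MatrixNorms.norm_ntr_le_opNorm` for the normalised trace; the same
    -- inequality is `QuantumLattice.norm_trace_le_card_mul_norm`, whose module is not imported to keep the closure small)
    have h1 : ‖(mlog (W j * fedSol W)).trace‖ ≤ Fintype.card n * ‖mlog (W j * fedSol W)‖ := by
      rcases isEmpty_or_nonempty n with hn | hn
      · simp [Matrix.trace]
      have hc : (0 : ℝ) < Fintype.card n := Nat.cast_pos.mpr Fintype.card_pos
      have h : ‖(mlog (W j * fedSol W)).trace / (Fintype.card n : ℂ)‖ ≤ ‖mlog (W j * fedSol W)‖ :=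
        MatrixNorms.norm_ntr_le_opNorm _
      rw [norm_div, Complex.norm_natCast, div_le_iff₀ hc] at h
      linarith [mul_comm (Fintype.card n : ℝ) ‖mlog (W j * fedSol W)‖]
    have h2 : ‖mlog (W j * fedSol W)‖ ≤ 2 * ‖W j * fedSol W - 1‖ :=
      norm_mlog_le_two_mul ((hA j).trans (by nlinarith))
    have hc : (0 : ℝ) ≤ Fintype.card n := Nat.cast_nonneg _
    have h3 : (Fintype.card n : ℝ) * ‖mlog (W j * fedSol W)‖ ≤ Fintype.card n * (2 * (403 / 100 * δ)) :=
      mul_le_mul_of_nonneg_left (h2.trans (by linarith [hA j])) hc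
    have := Real.pi_gt_three
    nlinarith
  have hexp : ∀ j, Complex.exp (mlog (W j * fedSol W)).trace = (fedSol W).det := by
    intro j
    rw [Complex.exp_eq_exp_ℂ, ← det_exp_eq_exp_trace, exp_mlog (hA1 j), Matrix.det_mul,
      (Matrix.mem_specialUnitaryGroup_iff.1 (hWs j)).2, one_mul]
  set j₀ : ι := Classical.arbitrary ι
  have heq : ∀ j, (mlog (W j * fedSol W)).trace = (mlog (W j₀ * fedSol W)).trace := fun j =>
    cexp_inj_of_norm_lt_pi (by rw [hexp, hexp]) (hz j) (hz j₀)
  have hsum : ∑ j, (mlog (W j * fedSol W)).trace = 0 := by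
    rw [← Matrix.trace_sum, sum_mlog_mul_fedSol hW', Matrix.trace_zero]
  have hz0 : (mlog (W j₀ * fedSol W)).trace = 0 := by
    simp only [heq, Finset.sum_const, Finset.card_univ, nsmul_eq_mul] at hsum
    exact (mul_eq_zero.1 hsum).resolve_left (Nat.cast_ne_zero.mpr Fintype.card_ne_zero)
  rw [← hexp j₀, hz0, Complex.exp_zero]

/-- **(0.9) on `SU(N)`**: the solution lies in `SU(N)`. [cite: Balaban1987RG1, (0.9) p.253] -/
theorem fedSol_mem_specialUnitaryGroup {δ : ℝ} (hδ : δ ≤ 1 / 100) (hδN : (Fintype.card n : ℝ) * δ ≤ 1 / 3)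
    {W : ι → Matrix n n ℂ} (hWs : ∀ j, W j ∈ Matrix.specialUnitaryGroup n ℂ) (hW : ∀ j, ‖W j - 1‖ ≤ δ) :
    fedSol W ∈ Matrix.specialUnitaryGroup n ℂ :=
  Matrix.mem_specialUnitaryGroup_iff.2
    ⟨fedSol_mem_unitaryGroup (fun j => (Matrix.mem_specialUnitaryGroup_iff.1 (hWs j)).1) fun j => (hW j).trans hδ,
      det_fedSol_eq_one hδ hδN hWs hW⟩

end Unitary

/-! ## 4. The group average `M` on matrix families `U₀, …, U_m`: (0.10), local uniqueness, (0.5)–(0.7) -/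

section Mean

open scoped Matrix.Norms.L2Operator

variable {n : Type*} [Fintype n] [DecidableEq n]
variable {m : ℕ}

/-- `SU(N)` is closed under adjoints. [folklore] -/
theorem star_mem_SU {X : Matrix n n ℂ} (hX : X ∈ Matrix.specialUnitaryGroup n ℂ) :
    star X ∈ Matrix.specialUnitaryGroup n ℂ :=
  (star (⟨X, hX⟩ : Matrix.specialUnitaryGroup n ℂ)).2

/-- The family relative to the base point `k`: `W_j = U_j U_k*`. [folklore] -/
def rel (U : Fin (m + 1) → Matrix n n ℂ) (k : Fin (m + 1)) : Fin (m + 1) → Matrix n n ℂ :=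
  fun j => U j * star (U k)

omit [DecidableEq n] in
/-- Unfolding `rel`. [folklore] -/
theorem rel_apply (U : Fin (m + 1) → Matrix n n ℂ) (k j : Fin (m + 1)) : rel U k j = U j * star (U k) := rfl

/-- **FEDERBUSH'S GROUP AVERAGE on matrix families** (print p.253 (0.10)): on a family all of whose quotients
`U_i U_k*` are within `δ` of `1`, `M U = X* U₀` where `X = fedSol (U_j U₀*)_j` solves `Σ_j log (U_j U₀* X) = 0` — so
that `Σ_j log (U_j M⁻¹) = 0` for unitary families (`M⁻¹ = M* = U₀* X`); the base value `U₀` off that guard.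
[cite: Balaban1987RG1, (0.10) p.253] -/
def fedM (δ : ℝ) (U : Fin (m + 1) → Matrix n n ℂ) : Matrix n n ℂ :=
  if ∀ i k, ‖U i * star (U k) - 1‖ < δ then star (fedSol (rel U 0)) * U 0 else U 0

variable {δ : ℝ} {U : Fin (m + 1) → Matrix n n ℂ}

/-- On the guard `fedM δ U = (fedSol (U_j U₀*))* U₀`. [folklore] -/
theorem fedM_of_small (h : ∀ i k, ‖U i * star (U k) - 1‖ < δ) : fedM δ U = star (fedSol (rel U 0)) * U 0 :=
  if_pos h

/-- Off the guard `fedM δ U = U₀`. [folklore] -/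
theorem fedM_of_not_small (h : ¬ ∀ i k, ‖U i * star (U k) - 1‖ < δ) : fedM δ U = U 0 := if_neg h

/-- On the guard with `δ ≤ 1/100` the relative family is in the domain of `fedSol`. [folklore] -/
theorem rel_small (h : ∀ i k, ‖U i * star (U k) - 1‖ < δ) (hδ : δ ≤ 1 / 100) (k j : Fin (m + 1)) :
    ‖rel U k j - 1‖ ≤ 1 / 100 := ((h j k).le).trans hδ

/-- The relative family of a unitary family is unitary. [folklore] -/
theorem rel_mem_unitaryGroup (hU : ∀ j, U j ∈ Matrix.unitaryGroup n ℂ) (k j : Fin (m + 1)) :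
    rel U k j ∈ Matrix.unitaryGroup n ℂ :=
  mul_mem (hU j) (Unitary.star_mem (hU k))

/-- The relative family of a special unitary family is special unitary. [folklore] -/
theorem rel_mem_specialUnitaryGroup (hU : ∀ j, U j ∈ Matrix.specialUnitaryGroup n ℂ) (k j : Fin (m + 1)) :
    rel U k j ∈ Matrix.specialUnitaryGroup n ℂ :=
  mul_mem (hU j) (star_mem_SU (hU k))

/-- **`M U` is unitary** for a unitary family (on and off the guard; `δ ≤ 1/100`). [cite: Balaban1987RG1, (0.9) p.253] -/
theorem fedM_mem_unitaryGroup (hU : ∀ j, U j ∈ Matrix.unitaryGroup n ℂ) (hδ : δ ≤ 1 / 100) :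
    fedM δ U ∈ Matrix.unitaryGroup n ℂ := by
  by_cases h : ∀ i k, ‖U i * star (U k) - 1‖ < δ
  · rw [fedM_of_small h]
    exact mul_mem (Unitary.star_mem (fedSol_mem_unitaryGroup (rel_mem_unitaryGroup hU 0) (rel_small h hδ 0)))
      (hU 0)
  · rw [fedM_of_not_small h]; exact hU 0

/-- **`M U ∈ SU(N)`** for a special unitary family and `δ ≤ min(1/100, 1/(3N))`. [cite: Balaban1987RG1, (0.9) p.253] -/
theorem fedM_mem_specialUnitaryGroup (hU : ∀ j, U j ∈ Matrix.specialUnitaryGroup n ℂ) (hδ : δ ≤ 1 / 100)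
    (hδN : (Fintype.card n : ℝ) * δ ≤ 1 / 3) : fedM δ U ∈ Matrix.specialUnitaryGroup n ℂ := by
  by_cases h : ∀ i k, ‖U i * star (U k) - 1‖ < δ
  · rw [fedM_of_small h]
    exact mul_mem (star_mem_SU
      (fedSol_mem_specialUnitaryGroup hδ hδN (rel_mem_specialUnitaryGroup hU 0) fun j => (h j 0).le)) (hU 0)
  · rw [fedM_of_not_small h]; exact hU 0

/-- **(0.10): `Σ_j (1/i) log (U_j M⁻¹) = 0`** — `M = fedM δ U` solves Federbush's implicit equation (unitary family on
the guard, `δ ≤ 1/100`; `M⁻¹ = M*`). [cite: Balaban1987RG1, (0.10) p.253] -/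
theorem sum_mlog_mul_star_fedM (hδ : δ ≤ 1 / 100) (h : ∀ i k, ‖U i * star (U k) - 1‖ < δ) :
    ∑ j, mlog (U j * star (fedM δ U)) = 0 := by
  rw [fedM_of_small h, star_mul, star_star]
  simp only [← mul_assoc]
  exact sum_mlog_mul_fedSol (rel_small h hδ 0)

/-- **LOCAL UNIQUENESS of the group average**: a unitary `M` with `‖M U₀* − 1‖ ≤ 2/25` solving
`Σ_j log (U_j M*) = 0` IS `fedM δ U` (unitary family on the guard, `δ ≤ 1/100`).  Every symmetry property below is
an instance of this. [cite: Balaban1987RG1, (0.10)–(0.11) p.253] -/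
theorem fedM_unique (hU : ∀ j, U j ∈ Matrix.unitaryGroup n ℂ) (hδ : δ ≤ 1 / 100)
    (h : ∀ i k, ‖U i * star (U k) - 1‖ < δ) {M : Matrix n n ℂ}
    (hd : ‖M * star (U 0) - 1‖ ≤ 2 / 25) (hsol : ∑ j, mlog (U j * star M) = 0) : M = fedM δ U := by
  have hU0 : star (U 0) * U 0 = 1 := Unitary.star_mul_self_of_mem (hU 0)
  have hY : star (M * star (U 0)) = fedSol (rel U 0) := by
    refine fedSol_unique (rel_small h hδ 0) (by rw [norm_star_sub_one]; exact hd) ?_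
    rw [fed_def, star_mul, star_star]
    have : ∀ j, rel U 0 j * (U 0 * star M) = U j * star M := fun j => by
      rw [rel_apply, show U j * star (U 0) * (U 0 * star M) = U j * (star (U 0) * U 0) * star M by noncomm_ring,
        hU0, mul_one]
    simp only [this, hsol, smul_zero]
  rw [fedM_of_small h, ← hY, star_star, mul_assoc, hU0, mul_one]

/-- `‖(M U) U₀* − 1‖ ≤ 3/100` on the guard: the average is close to the base point. [folklore] -/
theorem norm_fedM_mul_star_sub_one_le (hU : ∀ j, U j ∈ Matrix.unitaryGroup n ℂ) (hδ : δ ≤ 1 / 100)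
    (h : ∀ i k, ‖U i * star (U k) - 1‖ < δ) : ‖fedM δ U * star (U 0) - 1‖ ≤ 3 / 100 := by
  rw [fedM_of_small h, mul_assoc, Unitary.mul_star_self_of_mem (hU 0), mul_one, norm_star_sub_one]
  exact (fedSol_spec (rel_small h hδ 0)).1

/-- The sharper form: `‖(M U) U₀* − 1‖ ≤ 3δ'` whenever all `‖U_j U₀* − 1‖ ≤ δ' ≤ 1/100`. [folklore] -/
theorem norm_fedM_mul_star_sub_one_le_of_le (hU : ∀ j, U j ∈ Matrix.unitaryGroup n ℂ)
    (h : ∀ i k, ‖U i * star (U k) - 1‖ < δ) {δ' : ℝ} (hδ' : δ' ≤ 1 / 100) (h' : ∀ j, ‖U j * star (U 0) - 1‖ ≤ δ') :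
    ‖fedM δ U * star (U 0) - 1‖ ≤ 3 * δ' := by
  rw [fedM_of_small h, mul_assoc, Unitary.mul_star_self_of_mem (hU 0), mul_one, norm_star_sub_one]
  exact norm_fedSol_sub_one_le hδ' h'

/-- The guard transported along inversion of the family: `‖U_i* (U_k*)* − 1‖ = ‖U_i U_k* − 1‖`. [folklore] -/
theorem norm_star_mul_sub_one_eq (hU : ∀ j, U j ∈ Matrix.unitaryGroup n ℂ) (i k : Fin (m + 1)) :
    ‖star (U i) * star (star (U k)) - 1‖ = ‖U i * star (U k) - 1‖ := by
  have hk : star (U k) * U k = 1 := Unitary.star_mul_self_of_mem (hU k)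
  calc ‖star (U i) * star (star (U k)) - 1‖ = ‖star (star (U k) * U i) - 1‖ := by rw [star_mul]
    _ = ‖star (U k) * U i - 1‖ := norm_star_sub_one _
    _ = ‖star (U k) * (U i * star (U k)) * U k - 1‖ := by
        rw [show star (U k) * (U i * star (U k)) * U k = star (U k) * U i * (star (U k) * U k) by noncomm_ring,
          hk, mul_one]
    _ = ‖U i * star (U k) - 1‖ := norm_conj_sub_one_eq (Unitary.star_mem (hU k)) (hU k) hk

/-- The guard transported along two-sided translation: `‖(uU_iv)(uU_kv)* − 1‖ = ‖U_i U_k* − 1‖`. [folklore] -/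
theorem norm_conj_mul_sub_one_eq {u v : Matrix n n ℂ}
    (hu : u ∈ Matrix.unitaryGroup n ℂ) (hv : v ∈ Matrix.unitaryGroup n ℂ) (i k : Fin (m + 1)) :
    ‖u * U i * v * star (u * U k * v) - 1‖ = ‖U i * star (U k) - 1‖ := by
  have hvv : v * star v = 1 := Unitary.mul_star_self_of_mem hv
  rw [show u * U i * v * star (u * U k * v) = u * (U i * star (U k)) * star u by
    simp only [star_mul]
    rw [show u * U i * v * (star v * (star (U k) * star u)) = u * U i * (v * star v) * star (U k) * star u by
      noncomm_ring, hvv]; noncomm_ring]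
  exact norm_conj_sub_one_eq hu (Unitary.star_mem hu) (Unitary.mul_star_self_of_mem hu)

/-- **(0.5): `M({U_j⁻¹}) = M({U_j})⁻¹`** on the guard (unitary family, `δ ≤ 1/100`; inverses are adjoints).  By local
uniqueness: `M*` solves the equation of the inverted family, since `log (U_j* M) = −log (M* U_j) =
−M* log (U_j M*) M`. [cite: Balaban1987RG1, (0.5) p.253] -/
theorem fedM_star (hU : ∀ j, U j ∈ Matrix.unitaryGroup n ℂ) (hδ : δ ≤ 1 / 100)
    (h : ∀ i k, ‖U i * star (U k) - 1‖ < δ) : fedM δ (fun j => star (U j)) = star (fedM δ U) := by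
  have h' : ∀ i k, ‖star (U i) * star (star (U k)) - 1‖ < δ := fun i k => by
    rw [norm_star_mul_sub_one_eq hU]; exact h i k
  have hMu : fedM δ U ∈ Matrix.unitaryGroup n ℂ := fedM_mem_unitaryGroup hU hδ
  set M := fedM δ U with hM_def
  have hMM : star M * M = 1 := Unitary.star_mul_self_of_mem hMu
  have hMM' : M * star M = 1 := Unitary.mul_star_self_of_mem hMu
  symm
  refine fedM_unique (fun j => Unitary.star_mem (hU j)) hδ h' ?_ ?_
  · -- `‖M* U₀ − 1‖ = ‖U₀* (U₀ M*) U₀ − 1‖ = ‖(M U₀*)* − 1‖ ≤ 3/100`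
    have hU0 : star (U 0) * U 0 = 1 := Unitary.star_mul_self_of_mem (hU 0)
    rw [star_star, show star M * U 0 = star (U 0) * (U 0 * star M) * U 0 by
      rw [show star (U 0) * (U 0 * star M) * U 0 = (star (U 0) * U 0) * star M * U 0 by noncomm_ring, hU0, one_mul],
      norm_conj_sub_one_eq (Unitary.star_mem (hU 0)) (hU 0) hU0,
      show U 0 * star M = star (M * star (U 0)) by rw [star_mul, star_star], norm_star_sub_one]
    exact (norm_fedM_mul_star_sub_one_le hU hδ h).trans (by norm_num)
  · -- `Σ_j log (U_j* M) = −M* (Σ_j log (U_j M*)) M = 0`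
    have hsol := sum_mlog_mul_star_fedM hδ h
    rw [← hM_def] at hsol
    have hterm : ∀ j, mlog (star (U j) * star (star M)) = -(star M * mlog (U j * star M) * M) := by
      intro j
      rw [star_star]
      have hsmallj : ‖U j * star M - 1‖ ≤ 1 / 3 := by
        rw [show U j * star M = star (M * star (U j)) by rw [star_mul, star_star], norm_star_sub_one]
        -- `‖M U_j* − 1‖ ≤ ‖(M U₀*)(U₀ U_j*) − 1‖`-bound
        have h1 : ‖M * star (U 0) - 1‖ ≤ 3 / 100 := norm_fedM_mul_star_sub_one_le hU hδ h
        have h2 : ‖U 0 * star (U j) - 1‖ ≤ 1 / 100 := ((h 0 j).le).trans hδ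
        have := norm_mul_sub_one_le h1 h2
        rw [show M * star (U 0) * (U 0 * star (U j)) = M * (star (U 0) * U 0) * star (U j) by noncomm_ring,
          Unitary.star_mul_self_of_mem (hU 0), mul_one] at this
        exact this.trans (by norm_num)
      have hprod : U j * star M * (M * star (U j)) = 1 := by
        rw [show U j * star M * (M * star (U j)) = U j * (star M * M) * star (U j) by noncomm_ring, hMM, mul_one]
        exact Unitary.mul_star_self_of_mem (hU j)
      have hneg : mlog (M * star (U j)) = -mlog (U j * star M) := mlog_eq_neg_of_mul_eq_one hprod hsmallj
      -- `U_j* M = M* (M U_j*) M`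
      rw [show star (U j) * M = star M * (M * star (U j)) * M by
        rw [show star M * (M * star (U j)) * M = (star M * M) * star (U j) * M by noncomm_ring, hMM, one_mul],
        mlog_conj hMM hMM', hneg]
      noncomm_ring
    simp only [hterm]
    rw [Finset.sum_neg_distrib, ← Finset.sum_mul, ← Finset.mul_sum, hsol, mul_zero, zero_mul, neg_zero]

/-- **(0.6), TWO-SIDED: `M({uU_jv}) = u M({U_j}) v`** for unitary `u, v` on the guard (unitary family,
`δ ≤ 1/100`).  By local uniqueness: `uMv` solves the translated equation, `log (uU_jv (uMv)*) = u log (U_j M*) u*`.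
(The exp-mean-log average of the tree satisfies (0.6) for `v = u⁻¹` only.) [cite: Balaban1987RG1, (0.6) p.253] -/
theorem fedM_conj (hU : ∀ j, U j ∈ Matrix.unitaryGroup n ℂ) (hδ : δ ≤ 1 / 100)
    (h : ∀ i k, ‖U i * star (U k) - 1‖ < δ) {u v : Matrix n n ℂ} (hu : u ∈ Matrix.unitaryGroup n ℂ)
    (hv : v ∈ Matrix.unitaryGroup n ℂ) : fedM δ (fun j => u * U j * v) = u * fedM δ U * v := by
  have h' : ∀ i k, ‖u * U i * v * star (u * U k * v) - 1‖ < δ := fun i k => by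
    rw [norm_conj_mul_sub_one_eq hu hv]; exact h i k
  set M := fedM δ U with hM_def
  have huu : star u * u = 1 := Unitary.star_mul_self_of_mem hu
  have huu' : u * star u = 1 := Unitary.mul_star_self_of_mem hu
  have hvv : v * star v = 1 := Unitary.mul_star_self_of_mem hv
  symm
  refine fedM_unique (fun j => mul_mem (mul_mem hu (hU j)) hv) hδ h' ?_ ?_
  · rw [show u * M * v * star (u * U 0 * v) = u * (M * star (U 0)) * star u by
      simp only [star_mul]
      rw [show u * M * v * (star v * (star (U 0) * star u)) = u * M * (v * star v) * star (U 0) * star u by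
        noncomm_ring, hvv]; noncomm_ring,
      norm_conj_sub_one_eq hu (Unitary.star_mem hu) huu']
    exact (norm_fedM_mul_star_sub_one_le hU hδ h).trans (by norm_num)
  · have hsol := sum_mlog_mul_star_fedM hδ h
    rw [← hM_def] at hsol
    have hterm : ∀ j, mlog (u * U j * v * star (u * M * v)) = u * mlog (U j * star M) * star u := by
      intro j
      rw [show u * U j * v * star (u * M * v) = u * (U j * star M) * star u by
        simp only [star_mul]
        rw [show u * U j * v * (star v * (star M * star u)) = u * U j * (v * star v) * star M * star u by
          noncomm_ring, hvv]; noncomm_ring]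
      exact mlog_conj huu' huu _
    simp only [hterm]
    rw [← Finset.sum_mul, ← Finset.mul_sum, hsol, mul_zero, zero_mul]

/-- **(0.7): `M(π{U_j}) = M({U_j})`** — independence of the ORDER and of the BASE POINT (`U_{π0}` vs `U₀`) on the
guard (unitary family, `δ ≤ 1/100`).  By local uniqueness: `M` itself solves the permuted equation and
`‖M U_{π0}* − 1‖ ≤ ‖(M U₀*)(U₀ U_{π0}*) − 1‖ ≤ 2/25`. [cite: Balaban1987RG1, (0.7) p.253] -/
theorem fedM_perm (hU : ∀ j, U j ∈ Matrix.unitaryGroup n ℂ) (hδ : δ ≤ 1 / 100)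
    (h : ∀ i k, ‖U i * star (U k) - 1‖ < δ) (σ : Equiv.Perm (Fin (m + 1))) : fedM δ (U ∘ σ) = fedM δ U := by
  have h' : ∀ i k, ‖(U ∘ σ) i * star ((U ∘ σ) k) - 1‖ < δ := fun i k => h (σ i) (σ k)
  set M := fedM δ U with hM_def
  symm
  refine fedM_unique (fun j => hU (σ j)) hδ h' ?_ ?_
  · have h1 : ‖M * star (U 0) - 1‖ ≤ 3 / 100 := norm_fedM_mul_star_sub_one_le hU hδ h
    have h2 : ‖U 0 * star (U (σ 0)) - 1‖ ≤ 1 / 100 := ((h 0 (σ 0)).le).trans hδ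
    have := norm_mul_sub_one_le h1 h2
    rw [show M * star (U 0) * (U 0 * star (U (σ 0))) = M * (star (U 0) * U 0) * star (U (σ 0)) by noncomm_ring,
      Unitary.star_mul_self_of_mem (hU 0), mul_one] at this
    exact this.trans (by norm_num)
  · have hsol := sum_mlog_mul_star_fedM hδ h
    rw [← hM_def] at hsol
    change ∑ j, mlog (U (σ j) * star M) = 0
    exact (Equiv.sum_comp σ (fun j => mlog (U j * star M))).trans hsol

/-- **`M({U, …, U}) = U`**: the average of a constant unitary family is that element (`0 < δ ≤ 1/100`). [folklore] -/
theorem fedM_const (hδ0 : 0 < δ) (hδ : δ ≤ 1 / 100) {V : Matrix n n ℂ} (hV : V ∈ Matrix.unitaryGroup n ℂ) :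
    fedM δ (fun _ : Fin (m + 1) => V) = V := by
  have hVV : V * star V = 1 := Unitary.mul_star_self_of_mem hV
  have h : ∀ i k : Fin (m + 1), ‖(fun _ : Fin (m + 1) => V) i * star ((fun _ : Fin (m + 1) => V) k) - 1‖ < δ :=
    fun i k => by simp only [hVV, sub_self, norm_zero]; exact hδ0
  symm
  refine fedM_unique (fun _ => hV) hδ h (by rw [hVV, sub_self, norm_zero]; norm_num) ?_
  simp [hVV]

end Mean

/-! ## 5. The inhabitants of `GroupAverage U(N)` and `GroupAverage SU(N)`; measurability at every arity -/

section Group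

open scoped Matrix.Norms.L2Operator

variable {n : Type*} [Fintype n] [DecidableEq n] [Nonempty n]

/-- In the model `dist1 U = ‖U − 1‖` on `SU(N)` (`UnitaryModel` §4). [folklore] -/
theorem dist1_SU_eq (U : Matrix.specialUnitaryGroup n ℂ) : dist1 U = ‖(U : Matrix n n ℂ) - 1‖ := rfl

/-- In the model `dist1 U = ‖U − 1‖` on `U(N)` (`UnitaryModel` §4). [folklore] -/
theorem dist1_U_eq (U : Matrix.unitaryGroup n ℂ) : dist1 U = ‖(U : Matrix n n ℂ) - 1‖ := rfl

/-- `FamilySmall δ` on an `SU(N)`-family is the guard of `fedM δ` on its matrix family. [folklore] -/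
theorem familySmall_SU_iff {δ : ℝ} {m : ℕ} (U : Fin (m + 1) → Matrix.specialUnitaryGroup n ℂ) :
    FamilySmall δ U ↔ ∀ i k, ‖(U i : Matrix n n ℂ) * star (U k : Matrix n n ℂ) - 1‖ < δ := Iff.rfl

/-- `FamilySmall δ` on a `U(N)`-family is the guard of `fedM δ` on its matrix family. [folklore] -/
theorem familySmall_U_iff {δ : ℝ} {m : ℕ} (U : Fin (m + 1) → Matrix.unitaryGroup n ℂ) :
    FamilySmall δ U ↔ ∀ i k, ‖(U i : Matrix n n ℂ) * star (U k : Matrix n n ℂ) - 1‖ < δ := Iff.rfl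

/-- **The radius for `SU(N)`**: `δ_N = min(1/100, 1/(3N))` (so that `N·δ_N ≤ 1/3`, which makes the implicit mean
special unitary, §3). [folklore] -/
def deltaFed (n : Type*) [Fintype n] : ℝ := min (1 / 100) (1 / (3 * Fintype.card n))

omit [DecidableEq n] in
/-- `0 < δ_N`. [folklore] -/
theorem deltaFed_pos : 0 < deltaFed n := by
  have hc : (0 : ℝ) < Fintype.card n := Nat.cast_pos.mpr Fintype.card_pos
  exact lt_min (by norm_num) (by positivity)

omit [DecidableEq n] [Nonempty n] in
/-- `δ_N ≤ 1/100`. [folklore] -/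
theorem deltaFed_le : deltaFed n ≤ 1 / 100 := min_le_left _ _

omit [DecidableEq n] in
/-- `N · δ_N ≤ 1/3`. [folklore] -/
theorem card_mul_deltaFed_le : (Fintype.card n : ℝ) * deltaFed n ≤ 1 / 3 := by
  have hc : (0 : ℝ) < Fintype.card n := Nat.cast_pos.mpr Fintype.card_pos
  calc (Fintype.card n : ℝ) * deltaFed n ≤ Fintype.card n * (1 / (3 * Fintype.card n)) :=
        mul_le_mul_of_nonneg_left (min_le_right _ _) hc.le
    _ = 1 / 3 := by field_simp

variable {m : ℕ}

/-- **Federbush's group average on `SU(N)`-families** `U₀, …, U_m` (every arity), `SU(N)`-valued (§3–§4).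
[cite: Balaban1987RG1, (0.10) p.253] -/
def fedMSU (U : Fin (m + 1) → Matrix.specialUnitaryGroup n ℂ) : Matrix.specialUnitaryGroup n ℂ :=
  ⟨fedM (deltaFed n) (fun j => (U j : Matrix n n ℂ)),
    fedM_mem_specialUnitaryGroup (fun j => (U j).2) deltaFed_le card_mul_deltaFed_le⟩

/-- **Federbush's group average on `U(N)`-families** `U₀, …, U_m` (every arity), radius `1/100`, `U(N)`-valued.
[cite: Balaban1987RG1, (0.10) p.253] -/
def fedMU (U : Fin (m + 1) → Matrix.unitaryGroup n ℂ) : Matrix.unitaryGroup n ℂ :=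
  ⟨fedM (1 / 100) (fun j => (U j : Matrix n n ℂ)), fedM_mem_unitaryGroup (fun j => (U j).2) le_rfl⟩

/-- The matrix of `fedMSU U`. [folklore] -/
theorem coe_fedMSU (U : Fin (m + 1) → Matrix.specialUnitaryGroup n ℂ) :
    ((fedMSU U : Matrix.specialUnitaryGroup n ℂ) : Matrix n n ℂ) = fedM (deltaFed n) (fun j => (U j : Matrix n n ℂ)) :=
  rfl

omit [Nonempty n] in
/-- The matrix of `fedMU U`. [folklore] -/
theorem coe_fedMU (U : Fin (m + 1) → Matrix.unitaryGroup n ℂ) :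
    ((fedMU U : Matrix.unitaryGroup n ℂ) : Matrix n n ℂ) = fedM (1 / 100) (fun j => (U j : Matrix n n ℂ)) :=
  rfl

/-- **MEASURABILITY of the group average at every arity** (`SU(N)`): the guard is open, on it the map is continuous
(`fedSol` is Lipschitz, §2b), off it it is the continuous `U ↦ U₀`. [folklore] -/
theorem measurable_fedMSU (m : ℕ) :
    Measurable (fedMSU : (Fin (m + 1) → Matrix.specialUnitaryGroup n ℂ) → Matrix.specialUnitaryGroup n ℂ) := by
  set s : Set (Fin (m + 1) → Matrix.specialUnitaryGroup n ℂ) :=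
    {U | ∀ i k, ‖(U i : Matrix n n ℂ) * star (U k : Matrix n n ℂ) - 1‖ < deltaFed n} with hs_def
  have hcoe : ∀ i, Continuous fun U : Fin (m + 1) → Matrix.specialUnitaryGroup n ℂ => (U i : Matrix n n ℂ) :=
    fun i => continuous_subtype_val.comp (continuous_apply i)
  have hq : ∀ i k, Continuous fun U : Fin (m + 1) → Matrix.specialUnitaryGroup n ℂ =>
      (U i : Matrix n n ℂ) * star (U k : Matrix n n ℂ) - 1 :=
    fun i k => ((hcoe i).mul (hcoe k).star).sub continuous_const
  have hs_open : IsOpen s := by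
    rw [hs_def, Set.setOf_forall]
    refine isOpen_iInter_of_finite fun i => ?_
    rw [Set.setOf_forall]
    exact isOpen_iInter_of_finite fun k => isOpen_lt (hq i k).norm continuous_const
  have hrel : ContinuousOn (fun U : Fin (m + 1) → Matrix.specialUnitaryGroup n ℂ =>
      rel (fun j => (U j : Matrix n n ℂ)) 0) s :=
    (continuous_pi fun j => (hcoe j).mul (hcoe 0).star).continuousOn
  have hmaps : Set.MapsTo (fun U : Fin (m + 1) → Matrix.specialUnitaryGroup n ℂ =>
      rel (fun j => (U j : Matrix n n ℂ)) 0) s (smallFamilies (Fin (m + 1)) (Matrix n n ℂ) (1 / 100)) :=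
    fun U hU j => (hU j 0).trans_le deltaFed_le
  have hcont : ContinuousOn
      (fedMSU : (Fin (m + 1) → Matrix.specialUnitaryGroup n ℂ) → Matrix.specialUnitaryGroup n ℂ) s := by
    refine Topology.IsInducing.subtypeVal.continuousOn_iff.2 ?_
    have h1 : ContinuousOn (fun U : Fin (m + 1) → Matrix.specialUnitaryGroup n ℂ =>
        star (fedSol (rel (fun j => (U j : Matrix n n ℂ)) 0)) * (U 0 : Matrix n n ℂ)) s :=
      (continuous_star.comp_continuousOn (continuousOn_fedSol.comp hrel hmaps)).mul (hcoe 0).continuousOn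
    refine h1.congr fun U hU => ?_
    show ((fedMSU U : Matrix.specialUnitaryGroup n ℂ) : Matrix n n ℂ) = _
    rw [coe_fedMSU, fedM_of_small hU]
  have hcont' : ContinuousOn
      (fedMSU : (Fin (m + 1) → Matrix.specialUnitaryGroup n ℂ) → Matrix.specialUnitaryGroup n ℂ) sᶜ := by
    refine ((continuous_apply 0).continuousOn).congr fun U hU => ?_
    exact Subtype.ext (fedM_of_not_small hU)
  have hpw := ContinuousOn.measurable_piecewise hcont hcont' hs_open.measurableSet
  rwa [Set.piecewise_same] at hpw

omit [Nonempty n] in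
/-- **MEASURABILITY of the group average at every arity** (`U(N)`). [folklore] -/
theorem measurable_fedMU (m : ℕ) :
    Measurable (fedMU : (Fin (m + 1) → Matrix.unitaryGroup n ℂ) → Matrix.unitaryGroup n ℂ) := by
  set s : Set (Fin (m + 1) → Matrix.unitaryGroup n ℂ) :=
    {U | ∀ i k, ‖(U i : Matrix n n ℂ) * star (U k : Matrix n n ℂ) - 1‖ < 1 / 100} with hs_def
  have hcoe : ∀ i, Continuous fun U : Fin (m + 1) → Matrix.unitaryGroup n ℂ => (U i : Matrix n n ℂ) :=
    fun i => continuous_subtype_val.comp (continuous_apply i)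
  have hq : ∀ i k, Continuous fun U : Fin (m + 1) → Matrix.unitaryGroup n ℂ =>
      (U i : Matrix n n ℂ) * star (U k : Matrix n n ℂ) - 1 :=
    fun i k => ((hcoe i).mul (hcoe k).star).sub continuous_const
  have hs_open : IsOpen s := by
    rw [hs_def, Set.setOf_forall]
    refine isOpen_iInter_of_finite fun i => ?_
    rw [Set.setOf_forall]
    exact isOpen_iInter_of_finite fun k => isOpen_lt (hq i k).norm continuous_const
  have hrel : ContinuousOn (fun U : Fin (m + 1) → Matrix.unitaryGroup n ℂ =>
      rel (fun j => (U j : Matrix n n ℂ)) 0) s :=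
    (continuous_pi fun j => (hcoe j).mul (hcoe 0).star).continuousOn
  have hmaps : Set.MapsTo (fun U : Fin (m + 1) → Matrix.unitaryGroup n ℂ =>
      rel (fun j => (U j : Matrix n n ℂ)) 0) s (smallFamilies (Fin (m + 1)) (Matrix n n ℂ) (1 / 100)) :=
    fun U hU j => hU j 0
  have hcont : ContinuousOn (fedMU : (Fin (m + 1) → Matrix.unitaryGroup n ℂ) → Matrix.unitaryGroup n ℂ) s := by
    refine Topology.IsInducing.subtypeVal.continuousOn_iff.2 ?_
    have h1 : ContinuousOn (fun U : Fin (m + 1) → Matrix.unitaryGroup n ℂ =>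
        star (fedSol (rel (fun j => (U j : Matrix n n ℂ)) 0)) * (U 0 : Matrix n n ℂ)) s :=
      (continuous_star.comp_continuousOn (continuousOn_fedSol.comp hrel hmaps)).mul (hcoe 0).continuousOn
    refine h1.congr fun U hU => ?_
    show ((fedMU U : Matrix.unitaryGroup n ℂ) : Matrix n n ℂ) = _
    rw [coe_fedMU, fedM_of_small hU]
  have hcont' : ContinuousOn (fedMU : (Fin (m + 1) → Matrix.unitaryGroup n ℂ) → Matrix.unitaryGroup n ℂ) sᶜ := by
    refine ((continuous_apply 0).continuousOn).congr fun U hU => ?_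
    exact Subtype.ext (fedM_of_not_small hU)
  have hpw := ContinuousOn.measurable_piecewise hcont hcont' hs_open.measurableSet
  rwa [Set.piecewise_same] at hpw

/-- **THE INHABITANT OF `GroupAverage SU(N)` for every `N ≥ 1`**: Federbush's implicit group average (0.10), radius
`δ_N = min(1/100, 1/(3N))`, with (0.5), (0.6) two-sided and (0.7) PROVED on `δ_N`-small families.
[cite: Balaban1987RG1, (0.5)–(0.7), (0.9)–(0.10) p.253] -/
def federbushSU : GroupAverage (Matrix.specialUnitaryGroup n ℂ) where
  δ := deltaFed n
  δ_pos := deltaFed_pos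
  M := fun U => fedMSU U
  inv := fun U hU => by
    apply Subtype.ext
    show fedM (deltaFed n) (fun j => star (U j : Matrix n n ℂ)) = star (fedM (deltaFed n) fun j => (U j : Matrix n n ℂ))
    exact fedM_star (fun j => (U j).2.1) deltaFed_le ((familySmall_SU_iff U).1 hU)
  equivariant := fun U hU u v => by
    apply Subtype.ext
    show fedM (deltaFed n) (fun j => (u : Matrix n n ℂ) * (U j : Matrix n n ℂ) * (v : Matrix n n ℂ))
      = (u : Matrix n n ℂ) * fedM (deltaFed n) (fun j => (U j : Matrix n n ℂ)) * (v : Matrix n n ℂ)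
    exact fedM_conj (fun j => (U j).2.1) deltaFed_le ((familySmall_SU_iff U).1 hU) u.2.1 v.2.1
  perm := fun U hU σ => by
    apply Subtype.ext
    show fedM (deltaFed n) ((fun j => (U j : Matrix n n ℂ)) ∘ σ) = fedM (deltaFed n) (fun j => (U j : Matrix n n ℂ))
    exact fedM_perm (fun j => (U j).2.1) deltaFed_le ((familySmall_SU_iff U).1 hU) σ

/-- **THE INHABITANT OF `GroupAverage U(N)` for every `N ≥ 1`**: Federbush's implicit group average (0.10), radius
`1/100`, with (0.5), (0.6) two-sided and (0.7) PROVED on `1/100`-small families.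
[cite: Balaban1987RG1, (0.5)–(0.7), (0.9)–(0.10) p.253] -/
def federbushU : GroupAverage (Matrix.unitaryGroup n ℂ) where
  δ := 1 / 100
  δ_pos := by norm_num
  M := fun U => fedMU U
  inv := fun U hU => by
    apply Subtype.ext
    show fedM (1 / 100) (fun j => star (U j : Matrix n n ℂ)) = star (fedM (1 / 100) fun j => (U j : Matrix n n ℂ))
    exact fedM_star (fun j => (U j).2) le_rfl ((familySmall_U_iff U).1 hU)
  equivariant := fun U hU u v => by
    apply Subtype.ext
    show fedM (1 / 100) (fun j => (u : Matrix n n ℂ) * (U j : Matrix n n ℂ) * (v : Matrix n n ℂ))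
      = (u : Matrix n n ℂ) * fedM (1 / 100) (fun j => (U j : Matrix n n ℂ)) * (v : Matrix n n ℂ)
    exact fedM_conj (fun j => (U j).2) le_rfl ((familySmall_U_iff U).1 hU) u.2 v.2
  perm := fun U hU σ => by
    apply Subtype.ext
    show fedM (1 / 100) ((fun j => (U j : Matrix n n ℂ)) ∘ σ) = fedM (1 / 100) (fun j => (U j : Matrix n n ℂ))
    exact fedM_perm (fun j => (U j).2) le_rfl ((familySmall_U_iff U).1 hU) σ

/-- The radius of `federbushSU` is `δ_N = min(1/100, 1/(3N))`. [folklore] -/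
theorem federbushSU_δ : (federbushSU (n := n)).δ = deltaFed n := rfl

/-- The radius of `federbushU` is `1/100`. [folklore] -/
theorem federbushU_δ : (federbushU (n := n)).δ = 1 / 100 := rfl

/-- **`federbushSU.M` is measurable at every arity** — the hypothesis `MeasurableM` of the two-level apex
(`T4ApexTwoLevel.GroupAverage.MeasurableM`, whose body this is verbatim). [folklore] -/
theorem federbushSU_measurable : ∀ m : ℕ,
    Measurable fun U : Fin (m + 1) → Matrix.specialUnitaryGroup n ℂ => (federbushSU (n := n)).M U :=
  fun m => measurable_fedMSU m

/-- **`federbushU.M` is measurable at every arity.** [folklore] -/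
theorem federbushU_measurable : ∀ m : ℕ,
    Measurable fun U : Fin (m + 1) → Matrix.unitaryGroup n ℂ => (federbushU (n := n)).M U :=
  fun m => measurable_fedMU m

/-- **`federbushSU` SOLVES (0.10)**: `Σ_j (1/i) log (U_j · (M U)⁻¹) = 0` on every `δ_N`-small `SU(N)`-family (the
factor `1/i` is immaterial). [cite: Balaban1987RG1, (0.10) p.253] -/
theorem federbushSU_solves {U : Fin (m + 1) → Matrix.specialUnitaryGroup n ℂ}
    (hU : FamilySmall (federbushSU (n := n)).δ U) :
    ∑ j, mlog ((U j : Matrix n n ℂ) * (((federbushSU (n := n)).M U)⁻¹ : Matrix.specialUnitaryGroup n ℂ)) = 0 :=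
  sum_mlog_mul_star_fedM deltaFed_le ((familySmall_SU_iff U).1 hU)

/-- **`federbushU` SOLVES (0.10)** on every `1/100`-small `U(N)`-family. [cite: Balaban1987RG1, (0.10) p.253] -/
theorem federbushU_solves {U : Fin (m + 1) → Matrix.unitaryGroup n ℂ} (hU : FamilySmall (federbushU (n := n)).δ U) :
    ∑ j, mlog ((U j : Matrix n n ℂ) * (((federbushU (n := n)).M U)⁻¹ : Matrix.unitaryGroup n ℂ)) = 0 :=
  sum_mlog_mul_star_fedM le_rfl ((familySmall_U_iff U).1 hU)

/-- **LOCAL UNIQUENESS at group level (`SU(N)`)**: on a `δ_N`-small family, any `M' ∈ SU(N)` with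
`dist1 (M' U₀⁻¹) ≤ 2/25` solving (0.10) is `federbushSU.M U`. [cite: Balaban1987RG1, (0.10)–(0.11) p.253] -/
theorem federbushSU_unique {U : Fin (m + 1) → Matrix.specialUnitaryGroup n ℂ}
    (hU : FamilySmall (federbushSU (n := n)).δ U) {M' : Matrix.specialUnitaryGroup n ℂ}
    (hd : dist1 (M' * (U 0)⁻¹) ≤ 2 / 25)
    (hsol : ∑ j, mlog ((U j : Matrix n n ℂ) * ((M'⁻¹ : Matrix.specialUnitaryGroup n ℂ) : Matrix n n ℂ)) = 0) :
    M' = (federbushSU (n := n)).M U :=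
  Subtype.ext (fedM_unique (fun j => (U j).2.1) deltaFed_le ((familySmall_SU_iff U).1 hU) hd hsol)

/-- **The average of a constant family is that element** (`SU(N)`). [folklore] -/
theorem federbushSU_const (V : Matrix.specialUnitaryGroup n ℂ) :
    (federbushSU (n := n)).M (fun _ : Fin (m + 1) => V) = V :=
  Subtype.ext (fedM_const deltaFed_pos deltaFed_le V.2.1)

/-- **The average is `3δ'`-close to the base point** when the family is `δ'`-close to it (`δ' ≤ 1/100`, on the guard):
`dist1 ((M U) U₀⁻¹) ≤ 3δ'`. [folklore] -/
theorem federbushSU_dist1_le {U : Fin (m + 1) → Matrix.specialUnitaryGroup n ℂ}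
    (hU : FamilySmall (federbushSU (n := n)).δ U) {δ' : ℝ} (hδ' : δ' ≤ 1 / 100)
    (h' : ∀ j, dist1 (U j * (U 0)⁻¹) ≤ δ') : dist1 ((federbushSU (n := n)).M U * (U 0)⁻¹) ≤ 3 * δ' :=
  norm_fedM_mul_star_sub_one_le_of_le (fun j => (U j).2.1) ((familySmall_SU_iff U).1 hU) hδ' h'

end Group

end FederbushMean

end Literature.MathematicalPhysics.QuantumFieldTheory.Balaban1983to89
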